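import Summits.QuantumFields.YangMills.Theorems.BackwardLiouvilleRigidityHeightwiseRealisation
import Literature.MathematicalPhysics.QuantumFieldTheory.Balaban1983to89.T3MinimiserStabilityReduction
import Literature.MathematicalPhysics.QuantumFieldTheory.Balaban1983to89.T3PrintedRegularMinimiser
import Summits.QuantumFields.YangMills.Theorems.FluctuationComparisonRegPrIntLRunPairOrganIntegralOfTV
import Summits.QuantumFields.YangMills.Theorems.FluctuationComparisonRegPrIntLRunPairOrganWindowTV
import Summits.QuantumFields.YangMills.Theorems.FluctuationComparisonRegPrIntLRunPairOrganFiniteChain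
import Summits.QuantumFields.YangMills.Theorems.FluctuationComparisonRegPrIntLRunPairOrganInnerWindowChains
import Summits.QuantumFields.YangMills.Theorems.FluctuationComparisonRegPrIntLRunPairOrganRunWindowTailsOfFirstExit
import Summits.QuantumFields.YangMills.Theses.FirstExitWindow
import Summits.QuantumFields.YangMills.Theorems.FluctuationComparisonRegPrIntLRunPairOrganWindowTVOfSupOsc
import Summits.QuantumFields.YangMills.Theorems.FluctuationComparisonRegPrIntLOrganTangentSeedHTriple
import Summits.QuantumFields.YangMills.Theorems.FluctuationComparisonRegPrIntLOrganTangentSeedBudget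
import Summits.QuantumFields.YangMills.Theorems.FluctuationComparisonRegPrIntLOrganTangentAnchorFreeOscillation
import Summits.QuantumFields.YangMills.Theorems.BackwardLiouvilleRigidityFlatRatioTerminationThresholds
import Literature.MathematicalPhysics.QuantumFieldTheory.Balaban1983to89.B10Eq41TorusHistories
import Literature.MathematicalPhysics.QuantumFieldTheory.Balaban1983to89.T4CubeChartExp

/-!
# LEAD SCRATCH (w3 g24, private rehearsal — NOT a row of record, NOT the ideator's pen): COMPOSITION-v18
`unitLawCauchy_perL_of_H : RunClassMembershipH → RunWindowTails → RunPairSeed → BackwardStabilityFinSupH → WindowTVOsc → IntegralOfTV →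
(per-L Cauchy)` — v17.2's `unitLawCauchy_perL_of` (ll. 1131–1425) re-keyed to the H-texts (S1aᴴ with N2, S3ᴴ v0.2, ✓p798125 for S4b), the seed
step by ✓p799301 `seedTriple_of_seed_of_analytic_three` + px5 `normalisedSeed_le_frame`, inner-vs-outer window by ✓p652443 `stub_thresholds`.
Frame defs and the SFTower machinery are v17.2 VERBATIM.  Nothing of Bałaban's asserted; every organ is a HYPOTHESIS; 20520 ∕ `YM3TorusSU2`
NOT proved; R3 = SU(2) YM₃ on T³ — NOT d = 4, NOT infinite volume, NOT a mass gap, NOT Clay.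
-/

open MeasureTheory Filter Topology
open Literature.MathematicalPhysics.QuantumFieldTheory.Balaban1983to89 T3ContinuumYM3Torus T3NestedUnitLaws
  T3UnitLawDensityEML T4Continuum BalabanUVClass T3UnitScaleTilt T3PrintedRegularMinimiser
open T4CubeChartExp (expPt)

namespace Summit.QuantumFields.YangMills.Cruxes.FluctuationComparisonRegPrIntL.CompositionHScratch
/-! ### v17.2 (R-CUT-χ) · the smooth small-field cutoff of the rows (BY TEXT = `OrganTangent.sfCut`), used as the tower-cut weight -/

/-- The rows' smooth small-field cutoff (text identical with `Lines/organ_tangent.lean`'s `sfCut`): `1` where every plaquette distance is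
`≤ θ/2`, `0` as soon as one is `≥ (24/25)θ`, a product of clipped linear ramps in between (R-CUT-χ numerals (½, 24∕25)). -/
noncomputable def sfCut {P : Params} {k : ℕ} (θ : ℝ) (U : GaugeField P k ↥(Matrix.specialUnitaryGroup (Fin 2) ℂ)) : ℝ :=
  ∏ p : Plaq P k, max 0 (min 1 ((24 / 25 * θ - dist1 (GaugeField.plaqHol U p)) / ((24 / 25 - 1 / 2) * θ)))

theorem sfCut_nonneg {P : Params} {k : ℕ} (θ : ℝ) (U : GaugeField P k ↥(Matrix.specialUnitaryGroup (Fin 2) ℂ)) :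
    0 ≤ sfCut θ U :=
  Finset.prod_nonneg fun _ _ => le_max_left _ _

theorem sfCut_le_one {P : Params} {k : ℕ} (θ : ℝ) (U : GaugeField P k ↥(Matrix.specialUnitaryGroup (Fin 2) ℂ)) :
    sfCut θ U ≤ 1 :=
  Finset.prod_le_one (fun _ _ => le_max_left _ _) fun _ _ => max_le zero_le_one (min_le_left _ _)

/-- `{sfCut θ < 1} ⊆ {¬ PlaqSmall (θ/2)}`: the deficit of the smooth cut is read at the HALF window profile. -/
theorem not_plaqSmall_of_sfCut_lt_one {P : Params} {k : ℕ} {θ : ℝ} (hθ : 0 < θ)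
    {U : GaugeField P k ↥(Matrix.specialUnitaryGroup (Fin 2) ℂ)} (h : sfCut θ U < 1) : ¬ PlaqSmall (θ / 2) U := by
  intro hs
  refine (not_le.mpr h) (le_of_eq ?_)
  unfold sfCut
  refine (Finset.prod_eq_one fun p _ => ?_).symm
  have hp : dist1 (GaugeField.plaqHol U p) < θ / 2 := hs p
  have hden : 0 < (24 / 25 - 1 / 2) * θ := mul_pos (by norm_num) hθ
  have h1 : (1 : ℝ) ≤ (24 / 25 * θ - dist1 (GaugeField.plaqHol U p)) / ((24 / 25 - 1 / 2) * θ) := by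
    rw [le_div_iff₀ hden]; linarith
  rw [min_eq_left h1, max_eq_right zero_le_one]

theorem measurable_sfCut {P : Params} {k : ℕ} (θ : ℝ) :
    Measurable fun U : GaugeField P k ↥(Matrix.specialUnitaryGroup (Fin 2) ℂ) => sfCut θ U := by
  unfold sfCut
  refine Finset.measurable_prod _ fun p _ => ?_
  exact measurable_const.max (measurable_const.min ((measurable_const.sub
    (RegularGaugeGroup.measurable_dist1.comp (Missing.measurable_plaqHol p))).div_const ((24 / 25 - 1 / 2) * θ)))

/-- `θBal` is linear in `b₀` (`pFun b₀ p₀ g = b₀ · (1 + log g⁻¹)^{p₀}`). -/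
theorem θBal_half (L : ℕ) (γ b₀ p₀ : ℝ) (i : ℕ) : θBal L γ (b₀ / 2) p₀ i = θBal L γ b₀ p₀ i / 2 := by
  unfold θBal B10.pFun; ring

/-- S1a · RUN CLASS MEMBERSHIP (Bałaban's UV3 representation theorem, read on every run): for every large exponent `p₀` there are a
window constant `b₀`, a coupling threshold and an admissible parameter schedule such that for EVERY cut-off `K` the nested law of run `K`
at every height `j₀ ≤ j ≤ K` has a density (w.r.t. product Haar) that is positive and continuous on Bałaban's window and lies in the
class read on run `K` (`MemOfRun`).  Printed: [Balaban1985UV3] Thms 1–3, [Balaban1988RG2] Thm 1 (representation (0.3)–(0.12)). XL (port).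
v17 (R-a): stated for the SF-PROJECTED TOWER of run `K` below ANY seed height `Ts ≤ K` (the run itself at and above `Ts`, cut-consistency
`μ j = descend_* (sfCut θ_{j+1} · μ (j+1))` below (v17.1: smooth cut); the tower is determined by the run): its densities are window-positive,
window-continuous, carry the laws, and lie in the class read on run `K` MODULO A CONSTANT FACTOR `e^κ` (R-n4, critic g14 #527 Q1:
a (sub-)probability Haar-density concentrated on the window has log-height `≍ |T| log θ_j⁻¹`, while `Mem`'s `large`∕`stability` cap it at
`c5·|T| ≤ C₀|T|` — so membership of the NORMALISED density is false from a height on; Bałaban's densities (5)∕(47)∕(65) are not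
probability-normalised, and PATH B's one-bond ∕ 4-point differences never see the constant) — [Balaban1985UV3] (47)'s leading term. -/
def RunClassMembership : Prop :=
  ∀ (L : ℕ), ∃ pm : ℝ, 0 < pm ∧ ∀ (p₀ : ℝ), pm ≤ p₀ → ∃ b₀ : ℝ, 0 < b₀ ∧ ∃ γ₁ : ℝ, 0 < γ₁ ∧ ∀ (F : T3Family) (γ : ℝ), F.L = L → 0 < γ → γ ≤ γ₁ →
    ∃ (j₀ : ℕ) (prm : ℕ → ClassParams), AdmissibleClassParams F γ b₀ p₀ prm ∧
      ∀ (ν : ℕ → (j : ℕ) → Measure (GaugeField (F.P j) 0 (Matrix.specialUnitaryGroup (Fin 2) ℂ))),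
        (∀ K, ν K K = T4GenFunBounds.gibbsMeasure (F.P K) ((F.scheme ℰp γ).β K)) →
        (∀ K j, j < K → ν K j = Measure.map (descend F ℰp j) (ν K (j + 1))) →
        ∀ (K Ts : ℕ), Ts ≤ K → ∀ (μ : (j : ℕ) → Measure (GaugeField (F.P j) 0 (Matrix.specialUnitaryGroup (Fin 2) ℂ))),
          (∀ j, Ts ≤ j → μ j = ν K j) →
          (∀ j, j < Ts → μ j = Measure.map (descend F ℰp j) ((μ (j + 1)).withDensity (fun U => ENNReal.ofReal (sfCut (θBal F.L γ b₀ p₀ (j + 1)) U)))) →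
          ∃ ρ : (j : ℕ) → GaugeField (F.P j) 0 (Matrix.specialUnitaryGroup (Fin 2) ℂ) → ℝ,
            ∀ (j : ℕ) (hjK : j ≤ K), j₀ ≤ j →
              (∀ U, PlaqSmall (θBal F.L γ b₀ p₀ j) U → 0 < ρ j U) ∧
              μ j = (fieldMeasure _ _ _).withDensity (fun U => ENNReal.ofReal (ρ j U)) ∧
              (∃ κ : ℝ, MemOfRun F ℰp hjK (prm j) (fun U => Real.exp κ * ρ j U)) ∧
              ContinuousOn (ρ j) {U | PlaqSmall (θBal F.L γ b₀ p₀ j) U}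

/-- S1b · RUN WINDOW TAILS (per height, uniformly in the cut-off): the nested laws give Bałaban's window complement at height `j` a mass
`≤ η j`, summable in `j`, for every run `K ≥ j`.  Per block size this is the union bound over the FIRST-EXIT events of
`FirstExitWindow.FirstExitWindowTailL` (stmt 26243) summed over the finer heights; not printed as a probability estimate
([Balaban1985UV3] (71) p.46 gives the density-level large-field smallness). M given 26243 / L–XL outright. -/
def RunWindowTails : Prop :=
  ∃ pT : ℝ, 0 < pT ∧ ∀ (L : ℕ) (b₀ p₀ : ℝ), 0 < b₀ → pT ≤ p₀ → ∃ γ₁ : ℝ, 0 < γ₁ ∧ ∀ (F : T3Family) (γ : ℝ), F.L = L → 0 < γ → γ ≤ γ₁ →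
    ∃ η : ℕ → ℝ, (∀ j, 0 ≤ η j) ∧ Summable η ∧
      Summable (fun i => ∑' k, η (k + i)) ∧ Tendsto (fun j => (∑' k, η (k + j)) * ((1 + 2 * ((F.L : ℝ) ^ j / γ) * (Fintype.card (Plaq (F.P j) 0) : ℝ)) * (Fintype.card (PBond (F.P j) 0) : ℝ) ^ 2)) atTop (𝓝 0) ∧
      ∀ (ν : ℕ → (j : ℕ) → Measure (GaugeField (F.P j) 0 (Matrix.specialUnitaryGroup (Fin 2) ℂ))),
        (∀ K, ν K K = T4GenFunBounds.gibbsMeasure (F.P K) ((F.scheme ℰp γ).β K)) →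
        (∀ K j, j < K → ν K j = Measure.map (descend F ℰp j) (ν K (j + 1))) →
        ∀ (K j : ℕ), j ≤ K → ν K j {U | ¬ PlaqSmall (θBal F.L γ b₀ p₀ j) U} ≤ ENNReal.ofReal (η j)

/-- S2 · RUN-PAIR SEED (near-top universality, RATE-FREE): there are seed heights `J K ≤ K`, `J K → ∞`, and seed sizes `σ K → 0` with
`J K · σ K → 0`, such that for every pair of cut-offs `K ≤ K'` the log-ratio of the two runs' densities AT HEIGHT `J K` has `κ`-clustered
one-bond second differences `≤ σ K` on the window.  Mechanism: at depth `n = K − J K → ∞` below its own top, run `K`'s effective action is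
the `n`-step image of the Wilson action; two such images (depths `n ≤ n'`) differ by the tail `n ↦ ∞` of the CONVERGENT sequence of
`n`-step backgrounds / propagators ([Balaban1984PropagatorsI/II], [Balaban1985Variational]) plus irrelevant activities of size
`O(g_{J K}² p(g_{J K})^q)`; choosing `J K` adaptively (slowly) makes `J K · σ K → 0` WITHOUT any rate — only convergence is used.
Why it might fail: the convergence of the `n`-step quadratic forms is printed for propagators, not verbatim for the constrained minimal
ACTION as a functional of the window field (one-bond-oscillation currency). L. -/
def RunPairSeed : Prop :=
  ∀ (L : ℕ), ∃ pS : ℝ, ∀ (b₀ p₀ : ℝ), 0 < b₀ → pS ≤ p₀ → 0 < p₀ → ∃ γ₁ : ℝ, 0 < γ₁ ∧ ∃ κ : ℝ, 0 < κ ∧ ∀ (F : T3Family) (γ : ℝ), F.L = L → 0 < γ → γ ≤ γ₁ →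
    ∃ (J : ℕ → ℕ) (σ : ℕ → ℝ), (∀ K, 1 ≤ K → J K < K) ∧ (∀ K, J K ≤ K) ∧ Tendsto J atTop atTop ∧ (∀ K, 0 ≤ σ K) ∧
      Tendsto σ atTop (𝓝 0) ∧
      Tendsto (fun K => (J K : ℝ) * σ K) atTop (𝓝 0) ∧
      ∀ (ν : ℕ → (j : ℕ) → Measure (GaugeField (F.P j) 0 (Matrix.specialUnitaryGroup (Fin 2) ℂ))),
        (∀ K, ν K K = T4GenFunBounds.gibbsMeasure (F.P K) ((F.scheme ℰp γ).β K)) →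
        (∀ K j, j < K → ν K j = Measure.map (descend F ℰp j) (ν K (j + 1))) →
        ∀ (K K' : ℕ), K ≤ K' → ∀ (ρ₁ ρ₂ : GaugeField (F.P (J K)) 0 (Matrix.specialUnitaryGroup (Fin 2) ℂ) → ℝ),
          (∀ U, PlaqSmall (θBal F.L γ b₀ p₀ (J K)) U → 0 < ρ₁ U ∧ 0 < ρ₂ U) →
          ν K (J K) = (fieldMeasure _ _ _).withDensity (fun U => ENNReal.ofReal (ρ₁ U)) →
          ν K' (J K) = (fieldMeasure _ _ _).withDensity (fun U => ENNReal.ofReal (ρ₂ U)) →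
          ContinuousOn ρ₁ {U | PlaqSmall (θBal F.L γ b₀ p₀ (J K)) U} →
          ContinuousOn ρ₂ {U | PlaqSmall (θBal F.L γ b₀ p₀ (J K)) U} →
          ∀ (b b' : PBond (F.P (J K)) 0) (U V W Z : GaugeField (F.P (J K)) 0 (Matrix.specialUnitaryGroup (Fin 2) ℂ)),
            PlaqSmall (θBal F.L γ b₀ p₀ (J K)) U → PlaqSmall (θBal F.L γ b₀ p₀ (J K)) V →
            PlaqSmall (θBal F.L γ b₀ p₀ (J K)) W → PlaqSmall (θBal F.L γ b₀ p₀ (J K)) Z →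
            (∀ e, e ≠ b → U e = V e) → (∀ e, e ≠ b' → U e = W e) → (∀ e, e ≠ b' → V e = Z e) → (∀ e, e ≠ b → W e = Z e) →
            |(Real.log (ρ₁ U) - Real.log (ρ₂ U)) - (Real.log (ρ₁ V) - Real.log (ρ₂ V)) -
                ((Real.log (ρ₁ W) - Real.log (ρ₂ W)) - (Real.log (ρ₁ Z) - Real.log (ρ₂ Z)))|
              ≤ σ K * Real.exp (-(κ * (b.src.tdist b'.src : ℝ)))

/-- S2α · CLASSICAL TWO-DEPTH EQUILIBRATION (L; the load-bearing half of the seed S2 — v6 stage table): at EVERY height `J` the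
constrained minimal Wilson actions of two runs `K ≤ K'` over the SAME height-`J` datum, each in its own inverse temperature
(`β_K · minActionRegPr F J K`, print's minimum (8) over the regular space (6) [Balaban1985Variational]), have κ-clustered connected
4-point DISCREPANCY on Bałaban's window bounded by `P J · τ (K - J)`: an ARBITRARY height profile `P ≥ 0` (no uniformity in `J` is asked —
the diagonal schedule below absorbs any growth) times an antitone null DEPTH rate `τ`.  Heuristic: `β_K·min_{J,K} = β_J·Q_{K−J}` with the
`n`-step effective quadratic forms `Q_n → Q_∞` geometrically in `n` ([Balaban1985PropagatorsII] (1.33), convergence of the `k`-step Green's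
functions; abelian: [King1986] Prop. 3.10, in-tree `King1986.EffectiveLaplacianRate.prop310_uniform_bound`); second differences under
window moves `θ_J` give `P J ≈ C·p(g_J)²`, `τ n ≈ L^{-cn}`.  Classical ONLY: no densities, no laws.  Why it might fail: the printed convergence
is for the propagators / the linearisation, not verbatim for the NON-LINEAR constrained minimum over print's space (6) in 4-point currency,
and it needs the analyticity domain of `U_k(V)` ([Balaban1985Variational] Thm 1) uniform in `k` on the whole window. -/
def ClassicalTwoDepth : Prop :=
  ∀ (L : ℕ) (b₀ p₀ : ℝ), 0 < b₀ → 0 < p₀ → ∃ ε₁ : ℝ, 0 < ε₁ ∧ ∀ (ε₀ : ℝ), 0 < ε₀ → ε₀ ≤ ε₁ →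
    ∃ γ₁ : ℝ, 0 < γ₁ ∧ ∃ κ : ℝ, 0 < κ ∧ ∀ (F : T3Family) (γ : ℝ), F.L = L → 0 < γ → γ ≤ γ₁ →
      ∃ (P τ : ℕ → ℝ), (∀ n, 0 ≤ P n) ∧ (∀ n, 0 ≤ τ n) ∧ Antitone τ ∧ Tendsto τ atTop (𝓝 0) ∧
        ∀ (J K K' : ℕ) (hJK : J ≤ K) (hJK' : J ≤ K'), K ≤ K' →
          ∀ (b b' : PBond (F.P J) 0) (U V W Z : GaugeField (F.P J) 0 (Matrix.specialUnitaryGroup (Fin 2) ℂ)),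
            PlaqSmall (θBal F.L γ b₀ p₀ J) U → PlaqSmall (θBal F.L γ b₀ p₀ J) V →
            PlaqSmall (θBal F.L γ b₀ p₀ J) W → PlaqSmall (θBal F.L γ b₀ p₀ J) Z →
            (∀ e, e ≠ b → U e = V e) → (∀ e, e ≠ b' → U e = W e) → (∀ e, e ≠ b' → V e = Z e) → (∀ e, e ≠ b → W e = Z e) →
            |((F.scheme ℰp γ).β K * minActionRegPr F J K hJK ε₀ U - (F.scheme ℰp γ).β K' * minActionRegPr F J K' hJK' ε₀ U)
              - ((F.scheme ℰp γ).β K * minActionRegPr F J K hJK ε₀ V - (F.scheme ℰp γ).β K' * minActionRegPr F J K' hJK' ε₀ V)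
              - (((F.scheme ℰp γ).β K * minActionRegPr F J K hJK ε₀ W - (F.scheme ℰp γ).β K' * minActionRegPr F J K' hJK' ε₀ W)
                - ((F.scheme ℰp γ).β K * minActionRegPr F J K hJK ε₀ Z - (F.scheme ℰp γ).β K' * minActionRegPr F J K' hJK' ε₀ Z))|
              ≤ P J * τ (K - J) * Real.exp (-(κ * (b.src.tdist b'.src : ℝ)))

/-- S2α′ · CLASSICAL PER-HEIGHT EQUILIBRATION (L; v9 — the PLAIN form of S2α identified by idea-crit-5 #207(a)): at EVERY FIXED height `J`
the 4-point window discrepancy of the two runs' tree-level parts `β_K · minActionRegPr F J K` (print's constrained minimum (8) over the regular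
space (6) [Balaban1985Variational]) is bounded by a NULL DEPTH PROFILE `A_J (K − J)` of that height: `A_J ≥ 0`, `A_J → 0` — no uniformity in
`J`, no clustering factor, nothing else.  `classicalTwoDepth_of_perHeight` below PROVES S2α from it (tail suprema `Ā_J`, weights
`2^{-J}/(Ā_J 0 + 1)`, one summed antitone rate `τ` by dominated convergence, the clustering factor absorbed into `P J` through the finite
diameter of `PBond (F.P J) 0`).  This is the classical per-height convergence of renormalised constrained minima ([Balaban1985Variational] Thm 1,
[Balaban1985PropagatorsII] (1.33) for the quadratic part; abelian: `King1986.EffectiveLaplacianRate.prop310_uniform_bound`).  Why it might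
fail: as S2α — the printed convergence is for the propagators / the linearisation, not verbatim for the NON-LINEAR constrained minimum in
4-point currency on the whole window (analyticity domain of `U_k(V)` uniform in `k`); and boundedness of the discrepancy at SMALL depths is part
of the claim (`A_J 0 < ∞`), not only the Cauchy tail. -/
def ClassicalPerHeight : Prop :=
  ∀ (L : ℕ) (b₀ p₀ : ℝ), 0 < b₀ → 0 < p₀ → ∃ ε₁ : ℝ, 0 < ε₁ ∧ ∀ (ε₀ : ℝ), 0 < ε₀ → ε₀ ≤ ε₁ →
    ∃ γ₁ : ℝ, 0 < γ₁ ∧ ∀ (F : T3Family) (γ : ℝ), F.L = L → 0 < γ → γ ≤ γ₁ →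
      ∀ J : ℕ, ∃ A : ℕ → ℝ, (∀ n, 0 ≤ A n) ∧ Tendsto A atTop (𝓝 0) ∧
        ∀ (K K' : ℕ) (hJK : J ≤ K) (hJK' : J ≤ K'), K ≤ K' →
          ∀ (b b' : PBond (F.P J) 0) (U V W Z : GaugeField (F.P J) 0 (Matrix.specialUnitaryGroup (Fin 2) ℂ)),
            PlaqSmall (θBal F.L γ b₀ p₀ J) U → PlaqSmall (θBal F.L γ b₀ p₀ J) V →
            PlaqSmall (θBal F.L γ b₀ p₀ J) W → PlaqSmall (θBal F.L γ b₀ p₀ J) Z →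
            (∀ e, e ≠ b → U e = V e) → (∀ e, e ≠ b' → U e = W e) → (∀ e, e ≠ b' → V e = Z e) → (∀ e, e ≠ b → W e = Z e) →
            |((F.scheme ℰp γ).β K * minActionRegPr F J K hJK ε₀ U - (F.scheme ℰp γ).β K' * minActionRegPr F J K' hJK' ε₀ U)
              - ((F.scheme ℰp γ).β K * minActionRegPr F J K hJK ε₀ V - (F.scheme ℰp γ).β K' * minActionRegPr F J K' hJK' ε₀ V)
              - (((F.scheme ℰp γ).β K * minActionRegPr F J K hJK ε₀ W - (F.scheme ℰp γ).β K' * minActionRegPr F J K' hJK' ε₀ W)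
                - ((F.scheme ℰp γ).β K * minActionRegPr F J K hJK ε₀ Z - (F.scheme ℰp γ).β K' * minActionRegPr F J K' hJK' ε₀ Z))|
              ≤ A (K - J)

/-- S2β · FLUCTUATION PART SMALL IN 4-POINT CURRENCY (M–L; ONE run, CRUDE — no convergence in the depth is asked): for every run `K` and
height `J ≤ K`, the window log-density of the nested law MINUS its tree-level part, `log ρ + β_K · minActionRegPr F J K` ([Balaban1985UV3]
(41) expands around exactly this background), has κ-clustered connected 4-point size `≤ φ J` on the window, uniformly in the depth `K − J`,
with `J · φ J → 0`, for EVERY positive continuous density representative (representative-independent: two continuous versions agree on the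
window).  Heuristic: all quantum activities — the one-loop determinants included — are smooth local functionals with `O(1)` second derivatives
per unit volume in lattice units ([Balaban1985UV3] (45)–(47), [Balaban1988LargeField] (19)–(24)), so second differences under window moves are
`O(θ_J²·p^q) = O(γ L^{-J} p(g_J)^{q+2})` and `J·φ J → 0` with room to spare.  This is where the seed is CHEAP (B-9: at a height `J K → ∞`
anything `o(1/J)` suffices; no loop order has to converge).  Why it might fail: uniformity in the depth of the SECOND differences of the
activities (printed as bounds on the activities themselves, [Balaban1985UV3] (46)), and the large-field contributions to the window density
(relative weight `e^{-c p(g_j)²}` summed over heights above `J`, [Balaban1988LargeField] (24)) must also be `o(1/J)` in 4-point currency.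
WHERE THE EXTRA DERIVATIVE COMES FROM (idea-crit-5 #207 (ii), for the reader's docstring): the printed effective interaction terms
`ℰ^(k)(g₀, X, U₁)` are (a) gauge invariant (26), (b) localised in `X̃`, and (c) ANALYTIC in the coarse field `U₁` on the complexified small-field
window — [Balaban1985UV3] p.263, «the third property is the analyticity with respect to U₁ … these properties follow from the results of previous
papers» — with the sup-bounds (45)–(47) holding on that complex neighbourhood; one-bond SECOND differences of `log ρ + β_K·minAction` are then
Cauchy estimates (two derivatives × move size `θ_J`) applied term by term to the cluster expansion, the `e^{-κ·dist}` factor being the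
localisation (b) summed over clusters containing both bonds; the explicit one-loop determinant is differentiated through the background-field
propagator bounds of [Balaban1985-cmp99 «Propagators for lattice gauge theories in a background field»].  The reader must display the ratio
(move size / analyticity radius) at each height — if it is not small, the gain is only the sup-size of the `U₁`-DEPENDENT irrelevant terms. -/
def FluctuationPartSmall : Prop :=
  ∀ (L : ℕ), ∃ pS : ℝ, ∀ (b₀ p₀ : ℝ), 0 < b₀ → pS ≤ p₀ → 0 < p₀ → ∃ ε₁ : ℝ, 0 < ε₁ ∧ ∀ (ε₀ : ℝ), 0 < ε₀ → ε₀ ≤ ε₁ →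
    ∃ γ₁ : ℝ, 0 < γ₁ ∧ ∃ κ : ℝ, 0 < κ ∧ ∀ (F : T3Family) (γ : ℝ), F.L = L → 0 < γ → γ ≤ γ₁ →
      ∃ (φ : ℕ → ℝ), (∀ J, 0 ≤ φ J) ∧ Tendsto (fun J : ℕ => (J : ℝ) * φ J) atTop (𝓝 0) ∧
        ∀ (ν : ℕ → (j : ℕ) → Measure (GaugeField (F.P j) 0 (Matrix.specialUnitaryGroup (Fin 2) ℂ))),
          (∀ K, ν K K = T4GenFunBounds.gibbsMeasure (F.P K) ((F.scheme ℰp γ).β K)) →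
          (∀ K j, j < K → ν K j = Measure.map (descend F ℰp j) (ν K (j + 1))) →
          ∀ (J K : ℕ) (hJK : J ≤ K) (ρ : GaugeField (F.P J) 0 (Matrix.specialUnitaryGroup (Fin 2) ℂ) → ℝ),
            (∀ U, PlaqSmall (θBal F.L γ b₀ p₀ J) U → 0 < ρ U) →
            ν K J = (fieldMeasure _ _ _).withDensity (fun U => ENNReal.ofReal (ρ U)) →
            ContinuousOn ρ {U | PlaqSmall (θBal F.L γ b₀ p₀ J) U} →
            ∀ (b b' : PBond (F.P J) 0) (U V W Z : GaugeField (F.P J) 0 (Matrix.specialUnitaryGroup (Fin 2) ℂ)),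
              PlaqSmall (θBal F.L γ b₀ p₀ J) U → PlaqSmall (θBal F.L γ b₀ p₀ J) V →
              PlaqSmall (θBal F.L γ b₀ p₀ J) W → PlaqSmall (θBal F.L γ b₀ p₀ J) Z →
              (∀ e, e ≠ b → U e = V e) → (∀ e, e ≠ b' → U e = W e) → (∀ e, e ≠ b' → V e = Z e) → (∀ e, e ≠ b → W e = Z e) →
              |((Real.log (ρ U) + (F.scheme ℰp γ).β K * minActionRegPr F J K hJK ε₀ U)
                  - (Real.log (ρ V) + (F.scheme ℰp γ).β K * minActionRegPr F J K hJK ε₀ V))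
                - ((Real.log (ρ W) + (F.scheme ℰp γ).β K * minActionRegPr F J K hJK ε₀ W)
                  - (Real.log (ρ Z) + (F.scheme ℰp γ).β K * minActionRegPr F J K hJK ε₀ Z))|
                ≤ φ J * Real.exp (-(κ * (b.src.tdist b'.src : ℝ)))

/-- S3 · BACKWARD STABILITY ON FINITE RUNS, UNIFORM CONSTANTS (the ORGAN of route BackwardLiouvilleRigidity in its run-pair form): the
statement of `BackwardStabilityAdm` (stmt 23331) with (i) the towers only required to be consistent up to a finite TOP `T` and in the
admissible class on `j₀ ≤ j ≤ T`, (ii) the `κ`-clustered 4-point hypothesis only AT the top `T` (size `ωT`), and (iii) the constants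
`θ, C, w₀, ε, δ, j₁` chosen BEFORE the pair of towers (uniformity over pairs — automatic for any structural proof of the one-step organ
23156, whose registered lines `organ_fibre_laplace` / `backward_stability_adm` produce class constants), and (iv, v5) the tails
profile `η` hypothesised in the FLOOR CLASS (KT-η repair), and (v, v8 = repair R2 of width seat ym-line-sfw-p2-w3 g32) the towers carried
STRICTLY ABOVE the seed height: `∀ T Tt, T < Tt →` with consistency / class clauses up to `Tt` (O1's input at `T` is then the descent of
admissible height-`T+1` data, B-8(a); in the composition `Tt :=` the run's cut-off `K > J K`, for infinite towers `Tt := T + 1`).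
v16 text = `Summit.QuantumFields.YangMills.Theorems.FluctuationComparisonRegPrIntL.RunPairOrgan.BackwardStabilityFinSup` (p683255), kept below as
`BackwardStabilityFinSupGen`.  v17 (R-c + R-a): ANCHORED to the run family `ν` and a pair `K ≤ K'`, block top `Tt ≤ K`, towers = the runs on
`[T, Tt]` and their SF-projections below the seed∕input height `T` (cut-consistency); per-height clauses, the top 4-point hypothesis and the
one-bond conclusion BYTE-IDENTICAL to v16; membership clauses modulo constants (R-n4, as in O1).  DERIVED from O1 + FC
(`backwardStabilityFinSup_of_stubs`).  NOT PRINTED. XL. -/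
def BackwardStabilityFinSup : Prop :=
  ∃ γ₁ : ℝ, 0 < γ₁ ∧ ∀ (F : T3Family) (γ : ℝ), 0 < γ → γ ≤ γ₁ → ∀ (b₀ p₀ κ : ℝ) (j₀ : ℕ) (prm : ℕ → ClassParams) (η : ℕ → ℝ), 0 < b₀ → 0 < p₀ → AdmissibleClassParams F γ b₀ p₀ prm → 0 < κ → (∀ j, 0 ≤ η j) → Summable η → Summable (fun i => ∑' k, η (k + i)) → Tendsto (fun j => (∑' k, η (k + j)) * ((1 + 2 * ((F.L : ℝ) ^ j / γ) * (Fintype.card (Plaq (F.P j) 0) : ℝ)) * (Fintype.card (PBond (F.P j) 0) : ℝ) ^ 2)) atTop (𝓝 0) → ∃ (θ C w₀ : ℝ) (ε δ : ℕ → ℝ) (j₁ : ℕ), 0 < θ ∧ 0 ≤ C ∧ 0 < w₀ ∧ (∀ j, 0 ≤ ε j ∧ 0 ≤ δ j) ∧ Summable ε ∧ Summable δ ∧ Summable (fun i => ∑' k, δ (k + i)) ∧ Tendsto (fun j => (∑' k, δ (k + j)) * ((1 + 2 * ((F.L : ℝ) ^ j / γ) * (Fintype.card (Plaq (F.P j)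 0) : ℝ)) * (Fintype.card (PBond (F.P j) 0) : ℝ) ^ 2)) atTop (𝓝 0) ∧ j₀ ≤ j₁ ∧ ∀ (ν : ℕ → (j : ℕ) → MeasureTheory.Measure (GaugeField (F.P j) 0 ↥(Matrix.specialUnitaryGroup (Fin 2) ℂ))), (∀ K, ν K K = T4GenFunBounds.gibbsMeasure (F.P K) ((F.scheme ℰp γ).β K)) → (∀ K j, j < K → ν K j = Measure.map (descend F ℰp j) (ν K (j + 1))) → ∀ (K K' : ℕ), K ≤ K' → ∀ (T Tt : ℕ) (ωT : ℝ), T < Tt → Tt ≤ K → 0 ≤ ωT → ∀ (μ μ' : ((j : ℕ) → MeasureTheory.Measure (GaugeField (F.P j) 0 ↥(Matrix.specialUnitaryGroup (Fin 2) ℂ)))) (ρ ρ' : ((j : ℕ) → GaugeField (F.P j) 0 ↥(Matrix.specialUnitaryGroup (Fin 2) ℂ) → ℝ)), (∀ j : ℕ, T ≤ j → j ≤ Tt → μ j = ν K j ∧ μ' j = ν K' j) → (∀ j : ℕ, j < T → μ j = Measure.map (descend F ℰp j) ((μ (j + 1)).withDensity (fun U => ENNReal.ofReal (sfCut (θBal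 F.L γ b₀ p₀ (j + 1)) U))) ∧ μ' j = Measure.map (descend F ℰp j) ((μ' (j + 1)).withDensity (fun U => ENNReal.ofReal (sfCut (θBal F.L γ b₀ p₀ (j + 1)) U)))) → (∀ j : ℕ, T ≤ j → j < Tt → μ j = Measure.map (descend F ℰp j) (μ (j + 1)) ∧ μ' j = Measure.map (descend F ℰp j) (μ' (j + 1))) → (∀ j : ℕ, j ≤ Tt → IsFiniteMeasure (μ j) ∧ IsFiniteMeasure (μ' j)) → (∀ j : ℕ, j₀ ≤ j → j ≤ Tt → ((∀ U, PlaqSmall (θBal F.L γ b₀ p₀ j) U → 0 < ρ j U ∧ 0 < ρ' j U) ∧ μ j = (fieldMeasure _ _ _).withDensity (fun U => ENNReal.ofReal (ρ j U)) ∧ μ' j = (fieldMeasure _ _ _).withDensity (fun U => ENNReal.ofReal (ρ' j U)) ∧ (∃ κ : ℝ, MemAtHeight F ℰp j (prm j) (fun U => Real.exp κ * ρ j U)) ∧ (∃ κ : ℝ, MemAtHeight F ℰp j (prm j) (fun U => Real.exp κ * ρ' j U)) ∧ μ j {U | ¬ PlaqSmall (θBal F.L γ b₀ p₀ j) U} ≤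 ENNReal.ofReal (η j) ∧ μ' j {U | ¬ PlaqSmall (θBal F.L γ b₀ p₀ j) U} ≤ ENNReal.ofReal (η j) ∧ (ContinuousOn (ρ j) {U | PlaqSmall (θBal F.L γ b₀ p₀ j) U} ∧ ContinuousOn (ρ' j) {U | PlaqSmall (θBal F.L γ b₀ p₀ j) U}))) → (∀ (b b' : PBond (F.P T) 0) U V W Z, PlaqSmall (θBal F.L γ b₀ p₀ T) U → PlaqSmall (θBal F.L γ b₀ p₀ T) V → PlaqSmall (θBal F.L γ b₀ p₀ T) W → PlaqSmall (θBal F.L γ b₀ p₀ T) Z → (∀ e, e ≠ b → U e = V e) → (∀ e, e ≠ b' → U e = W e) → (∀ e, e ≠ b' → V e = Z e) → (∀ e, e ≠ b → W e = Z e) → |(Real.log (ρ T U) - Real.log (ρ' T U)) - (Real.log (ρ T V) - Real.log (ρ' T V)) - ((Real.log (ρ T W) - Real.log (ρ' T W)) - (Real.log (ρ T Z) - Real.log (ρ' T Z)))| ≤ ωT * Real.exp (-(κ * (b.src.tdist b'.src : ℝ)))) → ∀ (j : ℕ), j₁ ≤ j → j ≤ T → Real.exp (∑' k, ε k + 1)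 * (θ * ωT + (∑' k, δ (k + j))) ≤ w₀ → C * (Real.exp (∑' k, ε k + 1) * ((T : ℝ) * (θ * ωT) + (∑' i, ∑' k, δ (k + (i + j))))) ≤ 1 → ∀ (b : PBond (F.P j) 0) U V, PlaqSmall (θBal F.L γ b₀ p₀ j) U → PlaqSmall (θBal F.L γ b₀ p₀ j) V → (∀ e, e ≠ b → U e = V e) → |(Real.log (ρ j U) - Real.log (ρ' j U)) - (Real.log (ρ j V) - Real.log (ρ' j V))| ≤ Real.exp (∑' k, ε k + 1) * (θ * ωT + (∑' k, δ (k + j))) * (1 / θ + 2 * ((F.L : ℝ) ^ j / γ) * (Fintype.card (Plaq (F.P j) 0) : ℝ))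

/-- S3-GEN · the v16 ALL-TOWER text of S3, kept for the record and for the BLR edge `backwardStabilityAdmF_of_gen` (23877 BY NAME).
NOT derived in v17 (it would need the generic one-step organ, which typing note D25-8 reads as vacuous-or-false as typed); no stub asserts it. -/
def BackwardStabilityFinSupGen : Prop :=
  ∃ γ₁ : ℝ, 0 < γ₁ ∧ ∀ (F : T3Family) (γ : ℝ), 0 < γ → γ ≤ γ₁ → ∀ (b₀ p₀ κ : ℝ) (j₀ : ℕ) (prm : ℕ → ClassParams) (η : ℕ → ℝ), 0 < b₀ → 0 < p₀ → AdmissibleClassParams F γ b₀ p₀ prm → 0 < κ → (∀ j, 0 ≤ η j) → Summable η → Summable (fun i => ∑' k, η (k + i)) → Tendsto (fun j => (∑' k, η (k + j)) * ((1 + 2 * ((F.L : ℝ) ^ j / γ) * (Fintype.card (Plaq (F.P j) 0) : ℝ)) * (Fintype.card (PBond (F.P j) 0) : ℝ) ^ 2)) atTop (𝓝 0) → ∃ (θ C w₀ : ℝ) (ε δ : ℕ → ℝ) (j₁ : ℕ), 0 < θ ∧ 0 ≤ C ∧ 0 < w₀ ∧ (∀ j, 0 ≤ ε j ∧ 0 ≤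 δ j) ∧ Summable ε ∧ Summable δ ∧ Summable (fun i => ∑' k, δ (k + i)) ∧ Tendsto (fun j => (∑' k, δ (k + j)) * ((1 + 2 * ((F.L : ℝ) ^ j / γ) * (Fintype.card (Plaq (F.P j) 0) : ℝ)) * (Fintype.card (PBond (F.P j) 0) : ℝ) ^ 2)) atTop (𝓝 0) ∧ j₀ ≤ j₁ ∧ ∀ (T Tt : ℕ) (ωT : ℝ), T < Tt → 0 ≤ ωT → ∀ (μ μ' : ((j : ℕ) → MeasureTheory.Measure (GaugeField (F.P j) 0 ↥(Matrix.specialUnitaryGroup (Fin 2) ℂ)))) (ρ ρ' : ((j : ℕ) → GaugeField (F.P j) 0 ↥(Matrix.specialUnitaryGroup (Fin 2) ℂ) → ℝ)), (∀ j : ℕ, j ≤ Tt → IsProbabilityMeasure (μ j) ∧ IsProbabilityMeasure (μ' j)) → (∀ j : ℕ, j < Tt → μ j = Measure.map (descend F ℰp j) (μ (j + 1)) ∧ μ' j = Measure.map (descend F ℰp j) (μ' (j + 1))) → (∀ j : ℕ, j₀ ≤ j → j ≤ Tt → ((∀ U, PlaqSmall (θBal F.L γ b₀ p₀ j) U → 0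 < ρ j U ∧ 0 < ρ' j U) ∧ μ j = (fieldMeasure _ _ _).withDensity (fun U => ENNReal.ofReal (ρ j U)) ∧ μ' j = (fieldMeasure _ _ _).withDensity (fun U => ENNReal.ofReal (ρ' j U)) ∧ MemAtHeight F ℰp j (prm j) (ρ j) ∧ MemAtHeight F ℰp j (prm j) (ρ' j) ∧ μ j {U | ¬ PlaqSmall (θBal F.L γ b₀ p₀ j) U} ≤ ENNReal.ofReal (η j) ∧ μ' j {U | ¬ PlaqSmall (θBal F.L γ b₀ p₀ j) U} ≤ ENNReal.ofReal (η j) ∧ (ContinuousOn (ρ j) {U | PlaqSmall (θBal F.L γ b₀ p₀ j) U} ∧ ContinuousOn (ρ' j) {U | PlaqSmall (θBal F.L γ b₀ p₀ j) U}))) → (∀ (b b' : PBond (F.P T) 0) U V W Z, PlaqSmall (θBal F.L γ b₀ p₀ T) U → PlaqSmall (θBal F.L γ b₀ p₀ T) V → PlaqSmall (θBal F.L γ b₀ p₀ T) W → PlaqSmall (θBal F.L γ b₀ p₀ T) Z → (∀ e, e ≠ b → U e = V e) → (∀ e, e ≠ b' → U e = W e) → (∀ e, e ≠ b' → V e = Z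 e) → (∀ e, e ≠ b → W e = Z e) → |(Real.log (ρ T U) - Real.log (ρ' T U)) - (Real.log (ρ T V) - Real.log (ρ' T V)) - ((Real.log (ρ T W) - Real.log (ρ' T W)) - (Real.log (ρ T Z) - Real.log (ρ' T Z)))| ≤ ωT * Real.exp (-(κ * (b.src.tdist b'.src : ℝ)))) → ∀ (j : ℕ), j₁ ≤ j → j ≤ T → Real.exp (∑' k, ε k + 1) * (θ * ωT + (∑' k, δ (k + j))) ≤ w₀ → C * (Real.exp (∑' k, ε k + 1) * ((T : ℝ) * (θ * ωT) + (∑' i, ∑' k, δ (k + (i + j))))) ≤ 1 → ∀ (b : PBond (F.P j) 0) U V, PlaqSmall (θBal F.L γ b₀ p₀ j) U → PlaqSmall (θBal F.L γ b₀ p₀ j) V → (∀ e, e ≠ b → U e = V e) → |(Real.log (ρ j U) - Real.log (ρ' j U)) - (Real.log (ρ j V) - Real.log (ρ' j V))| ≤ Real.exp (∑' k, ε k + 1) * (θ * ωT + (∑' k, δ (k + j))) * (1 / θ + 2 * ((F.L : ℝ) ^ j / γ) * (Fintype.card (Plaq (F.P j) 0) : ℝ))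

/-- O1 · LOCAL ONE-STEP ORGAN ON FINITE TOWERS (g15 cut of S3; the organ reader's target).  UNIFORM constants
`θ, C, w₀, ε, εd, δ, j₁` (chosen before the towers), towers consistent and A♯-admissible on `[j₀, T]`, the step `j+1 → j` demanded only
for `j + 2 ≤ T` (the input at `j+1` is itself a descent of admissible height-`j+2` data: B-8(a) «a proof must use membership at two
consecutive heights»), input/output in the (c, a, w) currency of 23156 but with the irrelevant size `w` weighted in MARGINAL UNITS
`θ·w/(β_{j}θBal_j²) = θ·w/p(g_j)²` (KT-W: with a fixed absolute weight a Wilson-exact input jumps by `θ·m₁·p(g_j)²`; in marginal units the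
jump is the one-time `O(1)` loss `εd 0`), and losses `ε j` (height: one-loop coupling discrepancy `O(γL^{-j})`) PLUS `εd (T−(j+2))`
(DEPTH below the top: equilibration of the off-Wilson quadratic form, `‖Q_{n+1} − Q_n‖ = O(L^{-2n})`, [Balaban1984PropagatorsII],
[Balaban1985Variational]) — both summable — and a floor `δ` in the super-polynomial class, with the tails profile `η` hypothesised in the
SAME class (KT-η repair, `KT-ETA-summable-tails-g15.md`).  Why it might fail: the irrelevant→marginal mixing constant must be `O(1)` in
marginal units uniformly on the window (else no uniform θ), and the depth loss must not depend on the height.  XL.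
v16 (g25; LEAD WORD 16:09:38Z; typing note P25-1 «κ-CEILING»): the clustering rate is CAPPED — `∃ κ₀ > 0` (class constant = the response rate
`κ_cl(L)` of the step, chosen before `κ` and before the towers) and the step is claimed only for `0 < κ ≤ κ₀`, the SAME `κ` in the input clause
(height `j+1`) and the output clause (height `j`) as before.  FL-17's `κ*_∞(L)` (instrument, GUIDANCE) is the number `κ₀` would be typed from.
v17 (g25; ★★OWNER №139, LEAD w3 g22; typing note D25-8 «lf-transplant»): R-c — ANCHORED to the run family `ν` (tops = Gibbs, descents) and a pair
`K ≤ K'`; R-a — towers = the runs on `[Ts, T]` (`Ts` = seed height, `T ≤ K` = block top) and their SMALL-FIELD PROJECTIONS below `Ts`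
(cut-consistency `μ j = descend_* (sfCut θ_{j+1} · μ (j+1))`, v17.1 smooth cut), the step asked only for `j + 1 ≤ Ts`; per-height clauses and the
(c, a, w) input∕output texts byte-identical to v16 (they now read in PATH B's `h^{sf}` currency: `ρ_j = ∫ sfCut_{j+1}·ρ_{j+1} dσ`);
R-n4 (critic g14 #527 Q1) — the two class-membership clauses of the window block read MODULO A CONSTANT FACTOR
(`∃ κ, MemAtHeight … (e^κ·ρ_j)`): normalised densities cannot be members from a height on (`large`∕`stability` vs. window volume). -/
def OneStepContractionRun : Prop :=
  ∃ γ₁ : ℝ, 0 < γ₁ ∧ ∀ (F : T3Family) (γ : ℝ), 0 < γ → γ ≤ γ₁ → ∀ (b₀ p₀ : ℝ) (j₀ : ℕ) (prm : ℕ → ClassParams) (η : ℕ → ℝ), 0 < b₀ → 0 < p₀ → AdmissibleClassParams F γ b₀ p₀ prm → (∀ j, 0 ≤ η j) → Summable η → Summable (fun i => ∑' k, η (k + i)) → Tendsto (fun j => (∑' k, η (k + j)) * ((1 + 2 * ((F.L : ℝ) ^ j / γ) * (Fintype.card (Plaq (F.P j) 0) : ℝ)) * (Fintype.card (PBond (F.P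 j) 0) : ℝ) ^ 2)) atTop (𝓝 0) → ∃ κ₀ : ℝ, 0 < κ₀ ∧ ∀ (κ : ℝ), 0 < κ → κ ≤ κ₀ → ∃ (θ C w₀ : ℝ) (ε εd δ : ℕ → ℝ) (j₁ : ℕ), 0 < θ ∧ 0 ≤ C ∧ 0 < w₀ ∧ (∀ j, 0 ≤ ε j ∧ 0 ≤ εd j ∧ 0 ≤ δ j) ∧ Summable ε ∧ Summable εd ∧ Summable δ ∧ Summable (fun i => ∑' k, δ (k + i)) ∧ Tendsto (fun j => (∑' k, δ (k + j)) * ((1 + 2 * ((F.L : ℝ) ^ j / γ) * (Fintype.card (Plaq (F.P j) 0) : ℝ)) * (Fintype.card (PBond (F.P j) 0) : ℝ) ^ 2)) atTop (𝓝 0) ∧ j₀ ≤ j₁ ∧ ∀ (ν : ℕ → (j : ℕ) → MeasureTheory.Measure (GaugeField (F.P j) 0 ↥(Matrix.specialUnitaryGroup (Fin 2) ℂ))), (∀ K, ν K K = T4GenFunBounds.gibbsMeasure (F.P K) ((F.scheme ℰp γ).β K)) → (∀ K j, j < K → ν K j = Measure.map (descend F ℰp j) (ν K (j + 1))) → ∀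 (K K' : ℕ), K ≤ K' → ∀ (Ts T : ℕ), Ts < T → T ≤ K → ∀ (μ μ' : ((j : ℕ) → MeasureTheory.Measure (GaugeField (F.P j) 0 ↥(Matrix.specialUnitaryGroup (Fin 2) ℂ)))) (ρ ρ' : ((j : ℕ) → GaugeField (F.P j) 0 ↥(Matrix.specialUnitaryGroup (Fin 2) ℂ) → ℝ)), (∀ j : ℕ, Ts ≤ j → j ≤ T → μ j = ν K j ∧ μ' j = ν K' j) → (∀ j : ℕ, j < Ts → μ j = Measure.map (descend F ℰp j) ((μ (j + 1)).withDensity (fun U => ENNReal.ofReal (sfCut (θBal F.L γ b₀ p₀ (j + 1)) U))) ∧ μ' j = Measure.map (descend F ℰp j) ((μ' (j + 1)).withDensity (fun U => ENNReal.ofReal (sfCut (θBal F.L γ b₀ p₀ (j + 1)) U)))) → (∀ j : ℕ, Ts ≤ j → j < T → μ j = Measure.map (descend F ℰp j) (μ (j + 1)) ∧ μ' j = Measure.map (descend F ℰp j) (μ' (j + 1))) → (∀ j : ℕ, j ≤ T → IsFiniteMeasure (μ j) ∧ IsFiniteMeasure (μ' j)) → (∀ j : ℕ, j₀ ≤ j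 → j ≤ T → ((∀ U, PlaqSmall (θBal F.L γ b₀ p₀ j) U → 0 < ρ j U ∧ 0 < ρ' j U) ∧ μ j = (fieldMeasure _ _ _).withDensity (fun U => ENNReal.ofReal (ρ j U)) ∧ μ' j = (fieldMeasure _ _ _).withDensity (fun U => ENNReal.ofReal (ρ' j U)) ∧ (∃ κ : ℝ, MemAtHeight F ℰp j (prm j) (fun U => Real.exp κ * ρ j U)) ∧ (∃ κ : ℝ, MemAtHeight F ℰp j (prm j) (fun U => Real.exp κ * ρ' j U)) ∧ μ j {U | ¬ PlaqSmall (θBal F.L γ b₀ p₀ j) U} ≤ ENNReal.ofReal (η j) ∧ μ' j {U | ¬ PlaqSmall (θBal F.L γ b₀ p₀ j) U} ≤ ENNReal.ofReal (η j) ∧ (ContinuousOn (ρ j) {U | PlaqSmall (θBal F.L γ b₀ p₀ j) U} ∧ ContinuousOn (ρ' j) {U | PlaqSmall (θBal F.L γ b₀ p₀ j) U}))) → ∀ (j : ℕ), j₁ ≤ j → j + 2 ≤ T → j + 1 ≤ Ts → ∀ (c : Plaq (F.P (j + 1)) 0 → ℝ) (a w : ℝ), 0 ≤ a → 0 ≤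 w → a + θ / (((F.L : ℝ) ^ (j + 1) / γ) * θBal F.L γ b₀ p₀ (j + 1) ^ 2) * w ≤ w₀ → ((∀ p, |c p| ≤ a) ∧ (∀ (b b' : PBond (F.P (j + 1)) 0) U V W Z, PlaqSmall (θBal F.L γ b₀ p₀ (j + 1)) U → PlaqSmall (θBal F.L γ b₀ p₀ (j + 1)) V → PlaqSmall (θBal F.L γ b₀ p₀ (j + 1)) W → PlaqSmall (θBal F.L γ b₀ p₀ (j + 1)) Z → (∀ e, e ≠ b → U e = V e) → (∀ e, e ≠ b' → U e = W e) → (∀ e, e ≠ b' → V e = Z e) → (∀ e, e ≠ b → W e = Z e) → |(Real.log (ρ (j + 1) U) - Real.log (ρ' (j + 1) U) - ((F.L : ℝ) ^ (j + 1) / γ) * ∑ p, c p * (1 - reTr (GaugeField.plaqHol U p))) - (Real.log (ρ (j + 1) V) - Real.log (ρ' (j + 1) V) - ((F.L : ℝ) ^ (j + 1) / γ) * ∑ p, c p * (1 - reTr (GaugeField.plaqHol V p))) - ((Real.log (ρ (j + 1) W) - Real.log (ρ' (j + 1) W) - ((F.L : ℝ) ^ (j + 1) / γ) * ∑ p, c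 p * (1 - reTr (GaugeField.plaqHol W p))) - (Real.log (ρ (j + 1) Z) - Real.log (ρ' (j + 1) Z) - ((F.L : ℝ) ^ (j + 1) / γ) * ∑ p, c p * (1 - reTr (GaugeField.plaqHol Z p))))| ≤ w * Real.exp (-(κ * (b.src.tdist b'.src : ℝ))))) → ∃ (c' : Plaq (F.P j) 0 → ℝ) (a' w' : ℝ), 0 ≤ a' ∧ 0 ≤ w' ∧ a' + θ / (((F.L : ℝ) ^ j / γ) * θBal F.L γ b₀ p₀ j ^ 2) * w' ≤ (1 + ε j + εd (T - (j + 2)) + C * (a + θ / (((F.L : ℝ) ^ (j + 1) / γ) * θBal F.L γ b₀ p₀ (j + 1) ^ 2) * w)) * (a + θ / (((F.L : ℝ) ^ (j + 1) / γ) * θBal F.L γ b₀ p₀ (j + 1) ^ 2) * w) + δ j ∧ ((∀ p, |c' p| ≤ a') ∧ (∀ (b b' : PBond (F.P j) 0) U V W Z, PlaqSmall (θBal F.L γ b₀ p₀ j) U → PlaqSmall (θBal F.L γ b₀ p₀ j) V → PlaqSmall (θBal F.L γ b₀ p₀ j) W → PlaqSmall (θBal F.L γ b₀ p₀ j) Z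 → (∀ e, e ≠ b → U e = V e) → (∀ e, e ≠ b' → U e = W e) → (∀ e, e ≠ b' → V e = Z e) → (∀ e, e ≠ b → W e = Z e) → |(Real.log (ρ j U) - Real.log (ρ' j U) - ((F.L : ℝ) ^ j / γ) * ∑ p, c' p * (1 - reTr (GaugeField.plaqHol U p))) - (Real.log (ρ j V) - Real.log (ρ' j V) - ((F.L : ℝ) ^ j / γ) * ∑ p, c' p * (1 - reTr (GaugeField.plaqHol V p))) - ((Real.log (ρ j W) - Real.log (ρ' j W) - ((F.L : ℝ) ^ j / γ) * ∑ p, c' p * (1 - reTr (GaugeField.plaqHol W p))) - (Real.log (ρ j Z) - Real.log (ρ' j Z) - ((F.L : ℝ) ^ j / γ) * ∑ p, c' p * (1 - reTr (GaugeField.plaqHol Z p))))| ≤ w' * Real.exp (-(κ * (b.src.tdist b'.src : ℝ)))))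

/-- S4a · INNER-WINDOW CHAINS (= the derived theorem `innerWindowChains` of `Lines/flat_ratio_termination.lean`, BY STATEMENT; its three
registered stubs `stub_innerWindowGaugeSmall`, `stub_gaugeSmallChains`, `stub_thresholds` prove it there): every configuration of the inner
window `θBal F.L γ (√b₀) (p₀/2) j` is joined to `1` by `≤ #PBond_j²` one-bond moves inside the window. M/L (geometric). -/
def InnerWindowChains : Prop :=
  ∃ pW : ℝ, ∀ (p₀ : ℝ), pW ≤ p₀ → ∀ (F : T3Family) (γ b₀ : ℝ), 0 < γ → γ ≤ 1 → 0 < b₀ → ∃ jW : ℕ, ∀ j : ℕ, jW ≤ j → (∀ U : GaugeField (F.P j) 0 ↥(Matrix.specialUnitaryGroup (Fin 2) ℂ), PlaqSmall (θBal F.L γ (Real.sqrt b₀) (p₀ / 2) j) U → ∃ (n : ℕ) (W : ℕ → GaugeField (F.P j) 0 ↥(Matrix.specialUnitaryGroup (Fin 2) ℂ)), n ≤ Fintype.card (PBond (F.P j) 0) ^ 2 ∧ (∀ e, W 0 e = 1) ∧ W n = U ∧ (∀ i, i ≤ n → PlaqSmall (θBal F.L γ b₀ p₀ j) (W i)) ∧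 (∀ i, i < n → ∃ b : PBond (F.P j) 0, ∀ e, e ≠ b → W i e = W (i + 1) e))

/-- S4b · SINGLE-HEIGHT TV BOUND (= `stub_windowTV` of `Lines/flat_ratio_termination.lean`, BY STATEMENT): positivity on the window,
chains from the inner window, one-bond oscillation `τ` with `τ·D ≤ δ₀` and inner tails `≤ δ₀` force `|μ A − μ' A| ≤ ε`. M. -/
def WindowTV : Prop :=
  ∀ ε : ℝ, 0 < ε → ∃ δ₀ : ℝ, 0 < δ₀ ∧ ∀ (F : T3Family) (j D : ℕ) (θin θ τ ηr : ℝ), 0 < θin → 0 ≤ τ → τ * (D : ℝ) ≤ δ₀ → 0 ≤ ηr → ηr ≤ δ₀ → ∀ (μ μ' : MeasureTheory.Measure (GaugeField (F.P j) 0 ↥(Matrix.specialUnitaryGroup (Fin 2) ℂ))) (ρ ρ' : GaugeField (F.P j) 0 ↥(Matrix.specialUnitaryGroup (Fin 2) ℂ) → ℝ), IsProbabilityMeasure μ → IsProbabilityMeasure μ' → (∀ U, PlaqSmall θ U → 0 < ρ U ∧ 0 < ρ' U) → μ = (fieldMeasure _ _ _).withDensity (fun U => ENNReal.ofReal (ρ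 U)) → μ' = (fieldMeasure _ _ _).withDensity (fun U => ENNReal.ofReal (ρ' U)) → (∀ U : GaugeField (F.P j) 0 ↥(Matrix.specialUnitaryGroup (Fin 2) ℂ), PlaqSmall (θin) U → ∃ (n : ℕ) (W : ℕ → GaugeField (F.P j) 0 ↥(Matrix.specialUnitaryGroup (Fin 2) ℂ)), n ≤ D ∧ (∀ e, W 0 e = 1) ∧ W n = U ∧ (∀ i, i ≤ n → PlaqSmall (θ) (W i)) ∧ (∀ i, i < n → ∃ b : PBond (F.P j) 0, ∀ e, e ≠ b → W i e = W (i + 1) e)) → (∀ (b : PBond (F.P j) 0) U V, PlaqSmall θ U → PlaqSmall θ V → (∀ e, e ≠ b → U e = V e) → |(Real.log (ρ U) - Real.log (ρ' U)) - (Real.log (ρ V) - Real.log (ρ' V))| ≤ τ) → μ {U | ¬ PlaqSmall θin U} ≤ ENNReal.ofReal ηr → μ' {U | ¬ PlaqSmall θin U} ≤ ENNReal.ofReal ηr → ∀ A : Set (GaugeField (F.P j) 0 ↥(Matrix.specialUnitaryGroup (Fin 2) ℂ)), MeasurableSet A → |μ.real A - μ'.real A| ≤ ε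

/-- S4c · SET-CLOSENESS ⇒ INTEGRAL-CLOSENESS for observables bounded by one (layer cake on `f⁺`, `f⁻`). S. -/
def IntegralOfTV : Prop :=
  ∀ (F : T3Family) (j : ℕ) (μ μ' : MeasureTheory.Measure (GaugeField (F.P j) 0 ↥(Matrix.specialUnitaryGroup (Fin 2) ℂ))),
    IsProbabilityMeasure μ → IsProbabilityMeasure μ' → ∀ ε : ℝ, 0 ≤ ε →
    (∀ A : Set (GaugeField (F.P j) 0 ↥(Matrix.specialUnitaryGroup (Fin 2) ℂ)), MeasurableSet A → |μ.real A - μ'.real A| ≤ ε) →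
    ∀ f : GaugeField (F.P j) 0 ↥(Matrix.specialUnitaryGroup (Fin 2) ℂ) → ℝ, Measurable f → (∀ u, |f u| ≤ 1) →
      |(∫ u, f u ∂μ) - (∫ u, f u ∂μ')| ≤ 2 * ε


/-! ## v18 H-texts (V18DraftTexts v0.2 + N2; ✓p798125's statement) -/

/-- `HClauseSq θ r k R` · THE SCALED ONE-BOND-PAIR CLAUSE (tree text: ✓p797413 `firstDiff_window_path`'s hypothesis `h`, byte-identical body). -/
def HClauseSq {P : Params} {j : ℕ} (θ r : ℝ) (k : PBond P j → PBond P j → ℝ)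
    (R : GaugeField P j ↥(Matrix.specialUnitaryGroup (Fin 2) ℂ) → ℝ) : Prop :=
  ∀ (b b' : PBond P j) (v v' : Fin 3 → ℝ) (U V W Z : GaugeField P j ↥(Matrix.specialUnitaryGroup (Fin 2) ℂ)),
    ‖v‖ ≤ r * θ → ‖v'‖ ≤ r * θ → PlaqSmall θ U → PlaqSmall θ V → PlaqSmall θ W → PlaqSmall θ Z →
    (∀ e, e ≠ b → V e = U e) → V b = U b * expPt v → (∀ e, e ≠ b' → W e = U e) → W b' = U b' * expPt v' →
    (∀ e, e ≠ b' → Z e = V e) → Z b' = V b' * expPt v' →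
    |R Z - R V - R W + R U| ≤ k b b' * (‖v‖ / θ) * (‖v'‖ / θ)

/-- `AnalyticPairWindowAt θ r B f` · THE ANALYTICITY PREDICATE (β) — LEAD spec §1 text VERBATIM ([Balaban1985UV3] p.263 (c)): an INTERFACE. -/
def AnalyticPairWindowAt {P : Params} {j : ℕ} (θ r B : ℝ) (f : GaugeField P j ↥(Matrix.specialUnitaryGroup (Fin 2) ℂ) → ℝ) : Prop :=
  ∀ (U : GaugeField P j ↥(Matrix.specialUnitaryGroup (Fin 2) ℂ)), PlaqSmall θ U →
    ∀ (b b' : PBond P j) (v v' : Fin 3 → ℝ), ‖v‖ ≤ 1 → ‖v'‖ ≤ 1 →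
      ∃ g : ℂ × ℂ → ℂ, DifferentiableOn ℂ g (Metric.ball (0 : ℂ) (r * θ) ×ˢ Metric.ball (0 : ℂ) (r * θ)) ∧
        (∀ (s t : ℝ) (V Z : GaugeField P j ↥(Matrix.specialUnitaryGroup (Fin 2) ℂ)), |s| < r * θ → |t| < r * θ →
          (∀ e, e ≠ b → V e = U e) → V b = U b * expPt (s • v) → (∀ e, e ≠ b' → Z e = V e) → Z b' = V b' * expPt (t • v') →
          g ((s : ℂ), (t : ℂ)) = ((f Z : ℝ) : ℂ)) ∧
        ∀ z ∈ Metric.ball (0 : ℂ) (r * θ) ×ˢ Metric.ball (0 : ℂ) (r * θ), ‖g z - g 0‖ ≤ B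

/-- S1aᴴ · RUN CLASS MEMBERSHIP WITH ANALYTICITY — S1a `RunClassMembership` (v17.2 :211) VERBATIM plus, for the SAME density `ρ`, the
per-height (β) clause at window parameter `θBal∕2` with a radius `rA > 0` and the print-shaped oscillation bound `CB·β_j·θ_j² = CB·p(g_j)²`
(LEAD spec §1 caveat: the honest oscillation of `log ρ_j` on the `rA·θ_j`-bidisc is `≍ rA·p(g_j)²`), `rA, CB` chosen with `(j₀, prm)` (before the runs).
`RunClassMembershipH → RunClassMembership` by dropping the conjunct.  L (print: [Balaban1985UV3] p.263 (c), analyticity of the effective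
densities on the complexified small-field domain; the stub is the v18 L-debt `stub_runClassMembershipH`). -/
def RunClassMembershipH : Prop :=
  ∀ (L : ℕ), ∃ pm : ℝ, 0 < pm ∧ ∀ (p₀ : ℝ), pm ≤ p₀ → ∃ b₀ : ℝ, 0 < b₀ ∧ ∃ γ₁ : ℝ, 0 < γ₁ ∧ ∀ (F : T3Family) (γ : ℝ), F.L = L → 0 < γ → γ ≤ γ₁ →
    ∃ (j₀ : ℕ) (prm : ℕ → ClassParams) (rA CB : ℝ), AdmissibleClassParams F γ b₀ p₀ prm ∧ 0 < rA ∧ rA ≤ 1 / 12 ∧ 0 < CB ∧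
      ∀ (ν : ℕ → (j : ℕ) → Measure (GaugeField (F.P j) 0 (Matrix.specialUnitaryGroup (Fin 2) ℂ))),
        (∀ K, ν K K = T4GenFunBounds.gibbsMeasure (F.P K) ((F.scheme ℰp γ).β K)) →
        (∀ K j, j < K → ν K j = Measure.map (descend F ℰp j) (ν K (j + 1))) →
        ∀ (K Ts : ℕ), Ts ≤ K → ∀ (μ : (j : ℕ) → Measure (GaugeField (F.P j) 0 (Matrix.specialUnitaryGroup (Fin 2) ℂ))),
          (∀ j, Ts ≤ j → μ j = ν K j) →
          (∀ j, j < Ts → μ j = Measure.map (descend F ℰp j) ((μ (j + 1)).withDensity (fun U => ENNReal.ofReal (sfCut (θBal F.L γ b₀ p₀ (j + 1)) U)))) →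
          ∃ ρ : (j : ℕ) → GaugeField (F.P j) 0 (Matrix.specialUnitaryGroup (Fin 2) ℂ) → ℝ,
            ∀ (j : ℕ) (hjK : j ≤ K), j₀ ≤ j →
              (∀ U, PlaqSmall (θBal F.L γ b₀ p₀ j) U → 0 < ρ j U) ∧
              μ j = (fieldMeasure _ _ _).withDensity (fun U => ENNReal.ofReal (ρ j U)) ∧
              (∃ κ : ℝ, MemOfRun F ℰp hjK (prm j) (fun U => Real.exp κ * ρ j U)) ∧
              ContinuousOn (ρ j) {U | PlaqSmall (θBal F.L γ b₀ p₀ j) U} ∧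
              AnalyticPairWindowAt (θBal F.L γ b₀ p₀ j / 2) rA (CB * (((F.L : ℝ) ^ j / γ) * θBal F.L γ b₀ p₀ j ^ 2)) (fun U => Real.log (ρ j U))

/-- S3ᴴ · BACKWARD STABILITY ON FINITE RUNS, H-CURRENCY, SUP-OSCILLATION FORM (TN-OSC): S3 v17.2's frame with (β) in block ⑧, the H-seed at
`T`, and the conclusion = the inner-window sup-oscillation of `h_j` relative to `1` at path profile `b₀∕8`, RHS `(Cs·x_T + δ j)·β_j·(2·#Plaq_j + #PBond_j²)` (v0.2: (P-b′) v1.1's θ-free count kills the `1∕θ_j`).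
DERIVED (junction `directTransport_supR : OneStepTransportUH → BackwardStabilityFinSupH` over P-b′ + brick T + GRAnchorFree). NOT PRINTED. XL. -/
def BackwardStabilityFinSupH : Prop :=
  ∃ pW : ℝ, ∃ γ₁ : ℝ, 0 < γ₁ ∧ ∀ (F : T3Family) (γ : ℝ), 0 < γ → γ ≤ γ₁ →
  ∀ (b₀ p₀ κ : ℝ) (j₀ : ℕ) (prm : ℕ → ClassParams) (η : ℕ → ℝ) (rA : ℝ) (Bρ : ℕ → ℝ), 0 < b₀ → 0 < p₀ → pW ≤ p₀ → AdmissibleClassParams F γ b₀ p₀ prm → 0 < κ →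
  (∀ j, 0 ≤ η j) → Summable η → Summable (fun i => ∑' k, η (k + i)) →
  Tendsto (fun j => (∑' k, η (k + j)) * ((1 + 2 * ((F.L : ℝ) ^ j / γ) * (Fintype.card (Plaq (F.P j) 0) : ℝ)) * (Fintype.card (PBond (F.P j) 0) : ℝ) ^ 2)) atTop (𝓝 0) →
  0 < rA →
  ∃ (Cs w₀ : ℝ) (δ : ℕ → ℝ) (j₁ : ℕ), 0 ≤ Cs ∧ 0 < w₀ ∧ (∀ j, 0 ≤ δ j) ∧ Summable δ ∧ Summable (fun i => ∑' k, δ (k + i)) ∧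
  Tendsto (fun j => (∑' k, δ (k + j)) * ((1 + 2 * ((F.L : ℝ) ^ j / γ) * (Fintype.card (Plaq (F.P j) 0) : ℝ)) * (Fintype.card (PBond (F.P j) 0) : ℝ) ^ 2)) atTop (𝓝 0) ∧
  j₀ ≤ j₁ ∧
  ∀ (ν : ℕ → (j : ℕ) → MeasureTheory.Measure (GaugeField (F.P j) 0 ↥(Matrix.specialUnitaryGroup (Fin 2) ℂ))),
  (∀ K, ν K K = T4GenFunBounds.gibbsMeasure (F.P K) ((F.scheme ℰp γ).β K)) →
  (∀ K j, j < K → ν K j = Measure.map (descend F ℰp j) (ν K (j + 1))) →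
  ∀ (K K' : ℕ), K ≤ K' → ∀ (T Tt : ℕ), T < Tt → Tt ≤ K →
  ∀ (μ μ' : ((j : ℕ) → MeasureTheory.Measure (GaugeField (F.P j) 0 ↥(Matrix.specialUnitaryGroup (Fin 2) ℂ))))
    (ρ ρ' : ((j : ℕ) → GaugeField (F.P j) 0 ↥(Matrix.specialUnitaryGroup (Fin 2) ℂ) → ℝ)),
  (∀ j : ℕ, T ≤ j → j ≤ Tt → μ j = ν K j ∧ μ' j = ν K' j) →
  (∀ j : ℕ, j < T → μ j = Measure.map (descend F ℰp j) ((μ (j + 1)).withDensity (fun U => ENNReal.ofReal (sfCut (θBal F.L γ b₀ p₀ (j + 1)) U))) ∧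
    μ' j = Measure.map (descend F ℰp j) ((μ' (j + 1)).withDensity (fun U => ENNReal.ofReal (sfCut (θBal F.L γ b₀ p₀ (j + 1)) U)))) →
  (∀ j : ℕ, T ≤ j → j < Tt → μ j = Measure.map (descend F ℰp j) (μ (j + 1)) ∧ μ' j = Measure.map (descend F ℰp j) (μ' (j + 1))) →
  (∀ j : ℕ, j ≤ Tt → IsFiniteMeasure (μ j) ∧ IsFiniteMeasure (μ' j)) →
  (∀ j : ℕ, j₀ ≤ j → j ≤ Tt → ((∀ U, PlaqSmall (θBal F.L γ b₀ p₀ j) U → 0 < ρ j U ∧ 0 < ρ' j U) ∧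
    μ j = (fieldMeasure _ _ _).withDensity (fun U => ENNReal.ofReal (ρ j U)) ∧ μ' j = (fieldMeasure _ _ _).withDensity (fun U => ENNReal.ofReal (ρ' j U)) ∧
    (∃ κ : ℝ, MemAtHeight F ℰp j (prm j) (fun U => Real.exp κ * ρ j U)) ∧ (∃ κ : ℝ, MemAtHeight F ℰp j (prm j) (fun U => Real.exp κ * ρ' j U)) ∧
    μ j {U | ¬ PlaqSmall (θBal F.L γ b₀ p₀ j) U} ≤ ENNReal.ofReal (η j) ∧ μ' j {U | ¬ PlaqSmall (θBal F.L γ b₀ p₀ j) U} ≤ ENNReal.ofReal (η j) ∧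
    (ContinuousOn (ρ j) {U | PlaqSmall (θBal F.L γ b₀ p₀ j) U} ∧ ContinuousOn (ρ' j) {U | PlaqSmall (θBal F.L γ b₀ p₀ j) U}) ∧
    (AnalyticPairWindowAt (θBal F.L γ b₀ p₀ j / 2) rA (Bρ j) (fun U => Real.log (ρ j U)) ∧
      AnalyticPairWindowAt (θBal F.L γ b₀ p₀ j / 2) rA (Bρ j) (fun U => Real.log (ρ' j U))))) →
  ∀ (wT : ℝ), 0 ≤ wT → wT / (((F.L : ℝ) ^ T / γ) * θBal F.L γ b₀ p₀ T ^ 2) ≤ w₀ →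
  (∃ kT : PBond (F.P T) 0 → PBond (F.P T) 0 → ℝ, (∀ b b', 0 ≤ kT b b') ∧
    (∀ b, ∑ b', kT b b' * Real.exp (κ * (b.src.tdist b'.src : ℝ)) ≤ wT) ∧
    HClauseSq (θBal F.L γ b₀ p₀ T / 4) (rA / 2) kT (fun U => Real.log (ρ T U) - Real.log (ρ' T U))) →
  ∀ (j : ℕ), j₁ ≤ j → j ≤ T →
  ∀ U : GaugeField (F.P j) 0 ↥(Matrix.specialUnitaryGroup (Fin 2) ℂ), PlaqSmall (θBal F.L γ (Real.sqrt (b₀ / 8)) (p₀ / 2) j) U →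
    |(Real.log (ρ j U) - Real.log (ρ' j U)) - (Real.log (ρ j 1) - Real.log (ρ' j 1))| ≤
      (Cs * (wT / (((F.L : ℝ) ^ T / γ) * θBal F.L γ b₀ p₀ T ^ 2)) + δ j) *
        (((F.L : ℝ) ^ j / γ) * (2 * (Fintype.card (Plaq (F.P j) 0) : ℝ) + (Fintype.card (PBond (F.P j) 0) : ℝ) ^ 2))

/-- S4bᴴ · `WindowTVOsc` = ✓p798125 `RunPairOrganWindowTVOfSupOsc.windowTV_of_supOsc`'s statement VERBATIM. -/
def WindowTVOsc : Prop :=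
  ∀ ε : ℝ, 0 < ε → ∃ δ₀ : ℝ, 0 < δ₀ ∧ ∀ (F : T3Family) (j : ℕ) (θin θ τ ηr : ℝ), 0 < θin → θin ≤ θ → 0 ≤ τ → τ ≤ δ₀ → 0 ≤ ηr → ηr ≤ δ₀ →
    ∀ (μ μ' : MeasureTheory.Measure (GaugeField (F.P j) 0 ↥(Matrix.specialUnitaryGroup (Fin 2) ℂ)))
      (ρ ρ' : GaugeField (F.P j) 0 ↥(Matrix.specialUnitaryGroup (Fin 2) ℂ) → ℝ),
      IsProbabilityMeasure μ → IsProbabilityMeasure μ' → (∀ U, PlaqSmall θ U → 0 < ρ U ∧ 0 < ρ' U) →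
      μ = (fieldMeasure _ _ _).withDensity (fun U => ENNReal.ofReal (ρ U)) → μ' = (fieldMeasure _ _ _).withDensity (fun U => ENNReal.ofReal (ρ' U)) →
      (∀ U : GaugeField (F.P j) 0 ↥(Matrix.specialUnitaryGroup (Fin 2) ℂ), PlaqSmall θin U →
        |(Real.log (ρ U) - Real.log (ρ' U)) - (Real.log (ρ 1) - Real.log (ρ' 1))| ≤ τ) →
      μ {U | ¬ PlaqSmall θin U} ≤ ENNReal.ofReal ηr → μ' {U | ¬ PlaqSmall θin U} ≤ ENNReal.ofReal ηr →
      ∀ A : Set (GaugeField (F.P j) 0 ↥(Matrix.specialUnitaryGroup (Fin 2) ℂ)), MeasurableSet A → |μ.real A - μ'.real A| ≤ ε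

/-- S4bᴴ is ✓ by name. -/
theorem stub_windowTVOsc : WindowTVOsc :=
  Summit.QuantumFields.YangMills.Theorems.RunPairOrganWindowTVOfSupOsc.windowTV_of_supOsc

/-! ## v17 · SF-projected towers: construction and bookkeeping (abstract; no Bałaban input) -/

namespace SFTower


universe uT

variable {T : ℕ → Type uT} [∀ j, MeasurableSpace (T j)]

/-- The SF-projected tower below the seed height `Ts` (v17.1, SMOOTH cut): the given tower at and above `Ts`, and below it the
push-forward of the next level weighted by `χ (j+1)` (`withDensity`; `χ = 𝟙_W` recovers v17's sharp cut). -/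
noncomputable def sfTowerG (D : ∀ j, T (j + 1) → T j) (χ : ∀ j, T j → ENNReal) (ν : ∀ j, Measure (T j)) (Ts : ℕ) :
    ∀ j, Measure (T j)
  | j => if Ts ≤ j then ν j else Measure.map (D j) ((sfTowerG D χ ν Ts (j + 1)).withDensity (χ (j + 1)))
  termination_by j => Ts - j
  decreasing_by omega

theorem sfTowerG_of_le (D : ∀ j, T (j + 1) → T j) (χ : ∀ j, T j → ENNReal) (ν : ∀ j, Measure (T j)) {Ts j : ℕ} (h : Ts ≤ j) :
    sfTowerG D χ ν Ts j = ν j := by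
  rw [sfTowerG]; simp [h]

theorem sfTowerG_of_lt (D : ∀ j, T (j + 1) → T j) (χ : ∀ j, T j → ENNReal) (ν : ∀ j, Measure (T j)) {Ts j : ℕ} (h : j < Ts) :
    sfTowerG D χ ν Ts j = Measure.map (D j) ((sfTowerG D χ ν Ts (j + 1)).withDensity (χ (j + 1))) := by
  rw [sfTowerG]; simp [Nat.not_le.mpr h]

/-- Abstract bookkeeping for an SF-projected tower with weights `χ ≤ 1`: it lies below the full tower, and its mass deficit is at most
the sum of the full tower's masses of the sets `{χ_i < 1}` at the heights it was cut. -/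
theorem sfTower_le_and_deficit (D : ∀ j, T (j + 1) → T j) (hD : ∀ j, Measurable (D j)) (χ : ∀ j, T j → ENNReal)
    (hχm : ∀ j, Measurable (χ j)) (hχ1 : ∀ j x, χ j x ≤ 1)
    (ν μ : ∀ j, Measure (T j)) (Ts : ℕ)
    (hν : ∀ j, j < Ts → ν j = Measure.map (D j) (ν (j + 1)))
    (hanch : μ Ts = ν Ts)
    (hcut : ∀ j, j < Ts → μ j = Measure.map (D j) ((μ (j + 1)).withDensity (χ (j + 1)))) :
    ∀ n j, j + n = Ts → μ j ≤ ν j ∧ ν j Set.univ ≤ μ j Set.univ + ∑ i ∈ Finset.range n, ν (j + 1 + i) {x | χ (j + 1 + i) x < 1} := by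
  have hwd : ∀ (k : ℕ) (m : Measure (T k)), m.withDensity (χ k) ≤ m := fun k m =>
    (withDensity_mono (Eventually.of_forall (hχ1 k))).trans_eq (by simp)
  intro n
  induction n with
  | zero =>
    intro j hj
    simp only [add_zero] at hj
    subst hj
    simp [hanch]
  | succ n ih =>
    intro j hj
    have hjT : j < Ts := by omega
    obtain ⟨hle, hdef⟩ := ih (j + 1) (by omega)
    have hμj := hcut j hjT
    have hνj := hν j hjT
    refine ⟨?_, ?_⟩
    · rw [hμj, hνj]
      exact Measure.map_mono ((hwd _ _).trans hle) (hD j)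
    · have h1 : ν j Set.univ = ν (j + 1) Set.univ := by
        rw [hνj, Measure.map_apply (hD j) MeasurableSet.univ, Set.preimage_univ]
      have h2 : μ j Set.univ = ∫⁻ x, χ (j + 1) x ∂(μ (j + 1)) := by
        rw [hμj, Measure.map_apply (hD j) MeasurableSet.univ, Set.preimage_univ, withDensity_apply _ MeasurableSet.univ,
          Measure.restrict_univ]
      have hA : MeasurableSet {x | 1 ≤ χ (j + 1) x} := measurableSet_le measurable_const (hχm _)
      have h3a : μ (j + 1) {x | 1 ≤ χ (j + 1) x} ≤ ∫⁻ x, χ (j + 1) x ∂(μ (j + 1)) := by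
        calc μ (j + 1) {x | 1 ≤ χ (j + 1) x} = ∫⁻ x in {x | 1 ≤ χ (j + 1) x}, 1 ∂(μ (j + 1)) := by simp
          _ ≤ ∫⁻ x in {x | 1 ≤ χ (j + 1) x}, χ (j + 1) x ∂(μ (j + 1)) :=
              setLIntegral_mono (hχm _) fun x hx => hx
          _ ≤ ∫⁻ x, χ (j + 1) x ∂(μ (j + 1)) := setLIntegral_le_lintegral _ _
      have hc : {x | 1 ≤ χ (j + 1) x}ᶜ = {x | χ (j + 1) x < 1} := by
        ext x; simp [not_le]
      have h3 : μ (j + 1) Set.univ ≤ ∫⁻ x, χ (j + 1) x ∂(μ (j + 1)) + μ (j + 1) {x | χ (j + 1) x < 1} := by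
        calc μ (j + 1) Set.univ = μ (j + 1) ({x | 1 ≤ χ (j + 1) x} ∪ {x | 1 ≤ χ (j + 1) x}ᶜ) := by rw [Set.union_compl_self]
          _ ≤ μ (j + 1) {x | 1 ≤ χ (j + 1) x} + μ (j + 1) {x | 1 ≤ χ (j + 1) x}ᶜ := measure_union_le _ _
          _ ≤ ∫⁻ x, χ (j + 1) x ∂(μ (j + 1)) + μ (j + 1) {x | χ (j + 1) x < 1} := by rw [hc]; gcongr
      have h4 : μ (j + 1) {x | χ (j + 1) x < 1} ≤ ν (j + 1) {x | χ (j + 1) x < 1} := hle _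
      rw [h1, h2, Finset.sum_range_succ', add_zero]
      have h5 : ∑ i ∈ Finset.range n, ν (j + 1 + (i + 1)) {x | χ (j + 1 + (i + 1)) x < 1} =
          ∑ i ∈ Finset.range n, ν (j + 1 + 1 + i) {x | χ (j + 1 + 1 + i) x < 1} := by
        refine Finset.sum_congr rfl fun i _ => ?_
        have e : j + 1 + (i + 1) = j + 1 + 1 + i := by ring
        rw [e]
      rw [h5]
      calc ν (j + 1) Set.univ ≤ μ (j + 1) Set.univ + ∑ i ∈ Finset.range n, ν (j + 1 + 1 + i) {x | χ (j + 1 + 1 + i) x < 1} := hdef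
        _ ≤ (∫⁻ x, χ (j + 1) x ∂(μ (j + 1)) + μ (j + 1) {x | χ (j + 1) x < 1}) +
              ∑ i ∈ Finset.range n, ν (j + 1 + 1 + i) {x | χ (j + 1 + 1 + i) x < 1} := by
            gcongr
        _ ≤ (∫⁻ x, χ (j + 1) x ∂(μ (j + 1)) + ν (j + 1) {x | χ (j + 1) x < 1}) +
              ∑ i ∈ Finset.range n, ν (j + 1 + 1 + i) {x | χ (j + 1 + 1 + i) x < 1} := by
            gcongr
        _ = ∫⁻ x, χ (j + 1) x ∂(μ (j + 1)) + (∑ i ∈ Finset.range n, ν (j + 1 + 1 + i) {x | χ (j + 1 + 1 + i) x < 1} +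
              ν (j + 1 + 0) {x | χ (j + 1 + 0) x < 1}) := by
            rw [add_zero]; ring

variable {α : Type*} [MeasurableSpace α]

/-- TV transfer from the normalised SF-projected laws to the full laws. -/
theorem tv_transfer (ν ν' μ μ' : Measure α) [IsProbabilityMeasure ν] [IsProbabilityMeasure ν']
    (hle : μ ≤ ν) (hle' : μ' ≤ ν') {d d' e : ℝ} (hd : 0 ≤ d) (hd' : 0 ≤ d') (hd1 : d < 1) (hd1' : d' < 1)
    (hdef : ν Set.univ ≤ μ Set.univ + ENNReal.ofReal d) (hdef' : ν' Set.univ ≤ μ' Set.univ + ENNReal.ofReal d')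
    (htv : ∀ A, MeasurableSet A → |((μ Set.univ)⁻¹ • μ).real A - ((μ' Set.univ)⁻¹ • μ').real A| ≤ e) :
    ∀ A, MeasurableSet A → |ν.real A - ν'.real A| ≤ e + 2 * d + 2 * d' := by
  haveI : IsFiniteMeasure μ := isFiniteMeasure_of_le ν hle
  haveI : IsFiniteMeasure μ' := isFiniteMeasure_of_le ν' hle'
  -- masses
  have hm1 : μ.real Set.univ ≤ 1 := by
    have := ENNReal.toReal_mono (measure_ne_top ν _) (hle Set.univ)
    simpa [measureReal_def] using this
  have hm1' : μ'.real Set.univ ≤ 1 := by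
    have := ENNReal.toReal_mono (measure_ne_top ν' _) (hle' Set.univ)
    simpa [measureReal_def] using this
  have hmd : 1 - d ≤ μ.real Set.univ := by
    have h := ENNReal.toReal_mono (by simp [measure_ne_top]) hdef
    rw [ENNReal.toReal_add (measure_ne_top _ _) ENNReal.ofReal_ne_top, ENNReal.toReal_ofReal hd] at h
    simp only [measure_univ, ENNReal.toReal_one] at h
    rw [measureReal_def]; linarith
  have hmd' : 1 - d' ≤ μ'.real Set.univ := by
    have h := ENNReal.toReal_mono (by simp [measure_ne_top]) hdef'
    rw [ENNReal.toReal_add (measure_ne_top _ _) ENNReal.ofReal_ne_top, ENNReal.toReal_ofReal hd'] at h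
    simp only [measure_univ, ENNReal.toReal_one] at h
    rw [measureReal_def]; linarith
  have hmpos : 0 < μ.real Set.univ := by linarith
  have hmpos' : 0 < μ'.real Set.univ := by linarith
  -- the normalised measures on a set
  have hp : ∀ A, ((μ Set.univ)⁻¹ • μ).real A = μ.real A / μ.real Set.univ := by
    intro A
    rw [measureReal_def, Measure.smul_apply, smul_eq_mul, ENNReal.toReal_mul, ENNReal.toReal_inv, measureReal_def,
      measureReal_def, div_eq_inv_mul]
  have hp' : ∀ A, ((μ' Set.univ)⁻¹ • μ').real A = μ'.real A / μ'.real Set.univ := by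
    intro A
    rw [measureReal_def, Measure.smul_apply, smul_eq_mul, ENNReal.toReal_mul, ENNReal.toReal_inv, measureReal_def,
      measureReal_def, div_eq_inv_mul]
  intro A hA
  have h := htv A hA
  rw [hp, hp'] at h
  -- ν A - μ A ∈ [0, d]
  have hA1 : μ.real A ≤ ν.real A := by
    have := ENNReal.toReal_mono (measure_ne_top ν _) (hle A)
    simpa [measureReal_def] using this
  have hA1' : μ'.real A ≤ ν'.real A := by
    have := ENNReal.toReal_mono (measure_ne_top ν' _) (hle' A)
    simpa [measureReal_def] using this
  have hAc : μ.real Aᶜ ≤ ν.real Aᶜ := by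
    have := ENNReal.toReal_mono (measure_ne_top ν _) (hle Aᶜ)
    simpa [measureReal_def] using this
  have hAc' : μ'.real Aᶜ ≤ ν'.real Aᶜ := by
    have := ENNReal.toReal_mono (measure_ne_top ν' _) (hle' Aᶜ)
    simpa [measureReal_def] using this
  have hνc : ν.real A + ν.real Aᶜ = 1 := probReal_add_probReal_compl hA
  have hνc' : ν'.real A + ν'.real Aᶜ = 1 := probReal_add_probReal_compl hA
  have hμc : μ.real A + μ.real Aᶜ = μ.real Set.univ := measureReal_add_measureReal_compl hA
  have hμc' : μ'.real A + μ'.real Aᶜ = μ'.real Set.univ := measureReal_add_measureReal_compl hA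
  have hA2 : ν.real A - μ.real A ≤ d := by linarith
  have hA2' : ν'.real A - μ'.real A ≤ d' := by linarith
  -- μ A - p A ∈ [0, d]
  have hμA0 : 0 ≤ μ.real A := measureReal_nonneg
  have hμA0' : 0 ≤ μ'.real A := measureReal_nonneg
  have hpA : μ.real A / μ.real Set.univ ≤ 1 := by
    rw [div_le_one hmpos]; linarith [measureReal_nonneg (μ := μ) (s := Aᶜ)]
  have hpA' : μ'.real A / μ'.real Set.univ ≤ 1 := by
    rw [div_le_one hmpos']; linarith [measureReal_nonneg (μ := μ') (s := Aᶜ)]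
  have hA3 : |μ.real A - μ.real A / μ.real Set.univ| ≤ d := by
    have e1 : μ.real A - μ.real A / μ.real Set.univ = -((μ.real A / μ.real Set.univ) * (1 - μ.real Set.univ)) := by
      field_simp
      ring
    rw [e1, abs_neg, abs_of_nonneg (mul_nonneg (div_nonneg hμA0 hmpos.le) (by linarith))]
    calc μ.real A / μ.real Set.univ * (1 - μ.real Set.univ) ≤ 1 * (1 - μ.real Set.univ) :=
          mul_le_mul_of_nonneg_right hpA (by linarith)
      _ ≤ d := by linarith
  have hA3' : |μ'.real A - μ'.real A / μ'.real Set.univ| ≤ d' := by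
    have e1 : μ'.real A - μ'.real A / μ'.real Set.univ = -((μ'.real A / μ'.real Set.univ) * (1 - μ'.real Set.univ)) := by
      field_simp
      ring
    rw [e1, abs_neg, abs_of_nonneg (mul_nonneg (div_nonneg hμA0' hmpos'.le) (by linarith))]
    calc μ'.real A / μ'.real Set.univ * (1 - μ'.real Set.univ) ≤ 1 * (1 - μ'.real Set.univ) :=
          mul_le_mul_of_nonneg_right hpA' (by linarith)
      _ ≤ d' := by linarith
  rw [abs_le] at h hA3 hA3' ⊢
  constructor <;> linarith

/-- The normalised measure of a density measure is the density measure of the normalised density. -/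
theorem normalised_withDensity (dU μ : Measure α) (ρ : α → ℝ) (hρ : μ = dU.withDensity (fun U => ENNReal.ofReal (ρ U)))
    (h0 : μ Set.univ ≠ 0) (htop : μ Set.univ ≠ ⊤) :
    (μ Set.univ)⁻¹ • μ = dU.withDensity (fun U => ENNReal.ofReal ((μ Set.univ).toReal⁻¹ * ρ U)) := by
  have hm : 0 < (μ Set.univ).toReal := ENNReal.toReal_pos h0 htop
  have e1 : (fun U => ENNReal.ofReal ((μ Set.univ).toReal⁻¹ * ρ U)) = (μ Set.univ)⁻¹ • (fun U => ENNReal.ofReal (ρ U)) := by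
    funext U
    rw [Pi.smul_apply, smul_eq_mul, ENNReal.ofReal_mul (inv_nonneg.mpr hm.le), ENNReal.ofReal_inv_of_pos hm, ENNReal.ofReal_toReal htop]
  rw [e1, withDensity_smul' _ _ (ENNReal.inv_ne_top.mpr h0), ← hρ]

/-- Inner tails of the normalised measure. -/
theorem normalised_tail (μ ν : Measure α) (hle : μ ≤ ν) (S : Set α) {r : ℝ} (_hr : 0 ≤ r) (hS : ν S ≤ ENNReal.ofReal r)
    (hm : ENNReal.ofReal 2⁻¹ ≤ μ Set.univ) : ((μ Set.univ)⁻¹ • μ) S ≤ ENNReal.ofReal (2 * r) := by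
  rw [Measure.smul_apply, smul_eq_mul]
  have hm' : (2 : ENNReal)⁻¹ ≤ μ Set.univ := by
    rwa [ENNReal.ofReal_inv_of_pos two_pos, ENNReal.ofReal_ofNat] at hm
  have h1 : (μ Set.univ)⁻¹ ≤ 2 := by
    have := ENNReal.inv_le_inv.mpr hm'
    simpa using this
  calc (μ Set.univ)⁻¹ * μ S ≤ 2 * ENNReal.ofReal r := mul_le_mul' h1 ((hle S).trans hS)
    _ = ENNReal.ofReal (2 * r) := by rw [ENNReal.ofReal_mul (by norm_num : (0:ℝ) ≤ 2), ENNReal.ofReal_ofNat]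

/-- One-bond second differences do not see a normalisation. -/
theorem log_norm_diff {c c' x y x₂ y₂ : ℝ} (hc : 0 < c) (hc' : 0 < c') (hx : 0 < x) (hy : 0 < y) (hx₂ : 0 < x₂) (hy₂ : 0 < y₂) :
    (Real.log (c * x) - Real.log (c' * y)) - (Real.log (c * x₂) - Real.log (c' * y₂)) =
      (Real.log x - Real.log y) - (Real.log x₂ - Real.log y₂) := by
  rw [Real.log_mul hc.ne' hx.ne', Real.log_mul hc'.ne' hy.ne', Real.log_mul hc.ne' hx₂.ne', Real.log_mul hc'.ne' hy₂.ne']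
  ring

/-- The normalised measure is a probability measure. -/
theorem isProbabilityMeasure_normalised (μ : Measure α) (h0 : μ Set.univ ≠ 0) (htop : μ Set.univ ≠ ⊤) :
    IsProbabilityMeasure ((μ Set.univ)⁻¹ • μ) :=
  ⟨by rw [Measure.smul_apply, smul_eq_mul, ENNReal.inv_mul_cancel h0 htop]⟩

end SFTower

/-- v10 · THE UNIT LAW OF RUN `K` READ AT ANY HEIGHT `j ≤ K` OF ITS NESTED LAWS (v17.2 VERBATIM). -/
theorem integral_comp_unitA_nestedLaw (F : T3Family) {γ : ℝ}
    (ν : ℕ → (j : ℕ) → Measure (GaugeField (F.P j) 0 (Matrix.specialUnitaryGroup (Fin 2) ℂ)))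
    (h1 : ∀ K, ν K K = T4GenFunBounds.gibbsMeasure (F.P K) ((F.scheme ℰp γ).β K))
    (h2 : ∀ K j, j < K → ν K j = Measure.map (descend F ℰp j) (ν K (j + 1)))
    {g : GaugeField (F.P 0) 0 (Matrix.specialUnitaryGroup (Fin 2) ℂ) → ℝ} (hg : Measurable g) (K : ℕ) :
    ∀ j, j ≤ K → ∫ u, g (Literature.MathematicalPhysics.QuantumFieldTheory.Balaban1983to89.T3LevelShift.unitShift F j (Averaging.iter (fun i => BlockAveraging.blockAvg (P := F.P j) (j := i) ℰp) j u)) ∂(ν K j) =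
      ∫ u, g u ∂(F.unitLaw ℰp measurableE_ℰp γ K) := by
  have hmeas : ∀ j, Measurable fun u : GaugeField (F.P j) 0 (Matrix.specialUnitaryGroup (Fin 2) ℂ) => g (Literature.MathematicalPhysics.QuantumFieldTheory.Balaban1983to89.T3LevelShift.unitShift F j (Averaging.iter (fun i => BlockAveraging.blockAvg (P := F.P j) (j := i) ℰp) j u)) := fun j =>
    hg.comp ((Literature.MathematicalPhysics.QuantumFieldTheory.Balaban1983to89.T3LevelShift.measurable_unitShift F j).comp
      (Literature.MathematicalPhysics.QuantumFieldTheory.Balaban1983to89.T4Continuum.measurable_iter _ (F.avgMeasurable_of_measurableE ℰp measurableE_ℰp j) j))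
  rw [Literature.MathematicalPhysics.QuantumFieldTheory.Balaban1983to89.T3ThresholdRemoval.integral_unitLaw measurableE_ℰp K hg]
  suffices h : ∀ d j, j + d = K → ∫ u, g (Literature.MathematicalPhysics.QuantumFieldTheory.Balaban1983to89.T3LevelShift.unitShift F j (Averaging.iter (fun i => BlockAveraging.blockAvg (P := F.P j) (j := i) ℰp) j u)) ∂(ν K j) =
      ∫ u, g (Literature.MathematicalPhysics.QuantumFieldTheory.Balaban1983to89.T3LevelShift.unitShift F K (Averaging.iter (fun i => BlockAveraging.blockAvg (P := F.P K) (j := i) ℰp) K u)) ∂T4GenFunBounds.gibbsMeasure (F.P K) ((F.scheme ℰp γ).β K) from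
    fun j hj => h (K - j) j (by omega)
  intro d
  induction d with
  | zero =>
    intro j hj
    rw [add_zero] at hj
    subst hj
    rw [h1]
  | succ d ih =>
    intro j hj
    rw [h2 K j (by omega), integral_map (measurable_descend F ℰp measurableE_ℰp j).aemeasurable (hmeas j).aestronglyMeasurable,
      ← ih (j + 1) (by omega)]
    refine integral_congr_ae (Eventually.of_forall fun u => ?_)
    show g (Literature.MathematicalPhysics.QuantumFieldTheory.Balaban1983to89.T3LevelShift.unitShift F j (Averaging.iter (fun i => BlockAveraging.blockAvg (P := F.P j) (j := i) ℰp) j (descend F ℰp j u))) = _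
    rw [unitShift_iter_descend]

/-! ## COMPOSITION-v18 (LEAD scratch) -/

/-- `θBal (b₀/8) = θBal b₀ / 8` (the profile is linear in `b₀`). -/
theorem θBal_div8 (L : ℕ) (γ b₀ p₀ : ℝ) (i : ℕ) : θBal L γ (b₀ / 8) p₀ i = θBal L γ b₀ p₀ i / 8 := by
  simp only [θBal, B10.pFun]
  ring

/-- At least one plaquette. -/
theorem one_le_card_plaq (F : T3Family) (j : ℕ) : (1 : ℝ) ≤ (Fintype.card (Plaq (F.P j) 0) : ℝ) := by
  have h3 := B10Eq41TorusHistories.card_plaq_three (P := F.P j) rfl 0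
  have hS : 0 < Fintype.card (Site (F.P j) 0) := Fintype.card_pos
  have : 1 ≤ Fintype.card (Plaq (F.P j) 0) := by rw [h3]; omega
  exact_mod_cast this

/-- At least one bond (squared). -/
theorem one_le_card_pbond_sq (F : T3Family) (j : ℕ) : (1 : ℝ) ≤ (Fintype.card (PBond (F.P j) 0) : ℝ) ^ 2 := by
  have h := Summit.QuantumFields.YangMills.Theorems.FlatRatioTermination.card_pbond_T3 F j
  have hL : (1 : ℝ) ≤ F.L := by exact_mod_cast F.hL.2.le
  have hp : (1 : ℝ) ≤ (F.L : ℝ) ^ (F.m + j) := one_le_pow₀ hL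
  have h2 : (1 : ℝ) ≤ 3 * (2 * (F.L : ℝ) ^ (F.m + j)) ^ 3 := by
    have h1 : (1 : ℝ) ≤ 2 * (F.L : ℝ) ^ (F.m + j) := by linarith
    have h3 : (1 : ℝ) ≤ (2 * (F.L : ℝ) ^ (F.m + j)) ^ 3 := one_le_pow₀ h1
    linarith
  rw [h]
  exact one_le_pow₀ h2


/-- Masses of a sub-measure with deficit `d ≤ 1∕2` below a probability measure (v17.2's in-proof `hmass`, hoisted for the budget). -/
theorem mass_facts {α : Type*} [MeasurableSpace α] (νr μr : Measure α) [IsProbabilityMeasure νr] (hle : μr ≤ νr) {d : ℝ}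
    (hd0 : 0 ≤ d) (hd1 : d ≤ 1 / 2) (hdef : νr Set.univ ≤ μr Set.univ + ENNReal.ofReal d) :
    μr Set.univ ≠ 0 ∧ μr Set.univ ≠ ⊤ ∧ ENNReal.ofReal 2⁻¹ ≤ μr Set.univ := by
  have htop : μr Set.univ ≠ ⊤ := ((hle Set.univ).trans_lt (measure_lt_top _ _)).ne
  have h := ENNReal.toReal_mono (by simp [htop]) hdef
  rw [ENNReal.toReal_add htop ENNReal.ofReal_ne_top, ENNReal.toReal_ofReal hd0] at h
  simp only [measure_univ, ENNReal.toReal_one] at h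
  have hhalf : (2 : ℝ)⁻¹ ≤ (μr Set.univ).toReal := by
    rw [show (2 : ℝ)⁻¹ = 1 / 2 by norm_num]
    linarith
  refine ⟨fun h0 => by rw [h0, ENNReal.toReal_zero] at hhalf; norm_num at hhalf, htop, (ENNReal.ofReal_le_iff_le_toReal htop).mpr hhalf⟩

/-- ★ COMPOSITION-v18: the per-`L` Cauchy estimate for the unit laws from S1aᴴ, S1b, S2, S3ᴴ, S4bᴴ (= ✓p798125), S4c. -/
theorem unitLawCauchy_perL_of_H (h1a : RunClassMembershipH) (h1b : RunWindowTails) (h2 : RunPairSeed) (h3 : BackwardStabilityFinSupH)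
    (h4b : WindowTVOsc) (h4c : IntegralOfTV) (L : ℕ) :
    ∃ γ₁ : ℝ, 0 < γ₁ ∧ ∀ (F : T3Family) (γ : ℝ), F.L = L → 0 < γ → γ ≤ γ₁ →
    ∀ (g : GaugeField (F.P 0) 0 (Matrix.specialUnitaryGroup (Fin 2) ℂ) → ℝ), Measurable g → (∀ u, |g u| ≤ 1) →
      CauchySeq (fun K => ∫ u, g u ∂(F.unitLaw ℰp measurableE_ℰp γ K)) := by
  classical
  obtain ⟨pm, hpm, H1a⟩ := h1a L
  obtain ⟨pW, γe, hγe, H3⟩ := h3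
  obtain ⟨pW₂, HW₂⟩ := Summit.QuantumFields.YangMills.Theorems.FlatRatioTermination.stub_thresholds
  obtain ⟨pT, hpT, h1b⟩ := h1b
  obtain ⟨pS, h2L⟩ := h2 L
  set P0 : ℝ := max (max pm pW) (max (max 1 (2 * pT)) (max pS pW₂)) with hP0
  have hpm₀ : pm ≤ P0 := le_trans (le_max_left _ _) (le_max_left _ _)
  have hpW₀ : pW ≤ P0 := le_trans (le_max_right _ _) (le_max_left _ _)
  have h1le : (1 : ℝ) ≤ P0 := le_trans (le_trans (le_max_left _ _) (le_max_left _ _)) (le_max_right _ _)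
  have h2pT : 2 * pT ≤ P0 := le_trans (le_trans (le_max_right _ _) (le_max_left _ _)) (le_max_right _ _)
  have hpS₀ : pS ≤ P0 := le_trans (le_trans (le_max_left _ _) (le_max_right _ _)) (le_max_right _ _)
  have hpW₂ : pW₂ ≤ P0 := le_trans (le_trans (le_max_right _ _) (le_max_right _ _)) (le_max_right _ _)
  have hp₀ : 0 < P0 := lt_of_lt_of_le one_pos h1le
  have hpT₀ : pT ≤ P0 := by linarith
  have hpT2 : pT ≤ P0 / 2 := by linarith
  obtain ⟨b₀, hb₀, γa, hγa, H1a⟩ := H1a P0 hpm₀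
  have hb8 : 0 < b₀ / 8 := by positivity
  have hsb₀ : 0 < Real.sqrt (b₀ / 8) := Real.sqrt_pos.mpr hb8
  have hp₀2 : 0 < P0 / 2 := by positivity
  obtain ⟨γb, hγb, H1b⟩ := h1b L b₀ P0 hb₀ hpT₀
  obtain ⟨γc, hγc, H1c⟩ := h1b L (Real.sqrt (b₀ / 8)) (P0 / 2) hsb₀ hpT2
  obtain ⟨γd, hγd, κs, hκs, H2⟩ := h2L b₀ P0 hb₀ hpS₀ hp₀
  -- v17.1: S1b at the HALF window profile (deficit tails of the smooth cut)
  obtain ⟨γf, hγf, H1d⟩ := h1b L (b₀ / 2) P0 (half_pos hb₀) hpT₀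
  refine ⟨min (min (min γa γb) (min γc γd)) (min (min γe γf) 1), by positivity, ?_⟩
  intro F γ hFL hγ hle g hg hgb
  have hγa' : γ ≤ γa := hle.trans ((min_le_left _ _).trans ((min_le_left _ _).trans (min_le_left _ _)))
  have hγb' : γ ≤ γb := hle.trans ((min_le_left _ _).trans ((min_le_left _ _).trans (min_le_right _ _)))
  have hγc' : γ ≤ γc := hle.trans ((min_le_left _ _).trans ((min_le_right _ _).trans (min_le_left _ _)))
  have hγd' : γ ≤ γd := hle.trans ((min_le_left _ _).trans ((min_le_right _ _).trans (min_le_right _ _)))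
  have hγe' : γ ≤ γe := hle.trans ((min_le_right _ _).trans ((min_le_left _ _).trans (min_le_left _ _)))
  have hγf' : γ ≤ γf := hle.trans ((min_le_right _ _).trans ((min_le_left _ _).trans (min_le_right _ _)))
  have hγ1 : γ ≤ 1 := hle.trans ((min_le_right _ _).trans (min_le_right _ _))
  -- nested laws of the runs and the data delivered by S1aᴴ, S1b (outer, inner, half profile), S2, S3ᴴ, thresholds
  obtain ⟨ν, hν1, hν2, hν3⟩ :=
    Summit.QuantumFields.YangMills.Theorems.BackwardLiouvilleRigidityHeightwiseRealisation.exists_nestedLaws F hγ.le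
  obtain ⟨j₀, prm, rA, CB, hadm, hrA, hrA12, hCB, Hρ⟩ := H1a F γ hFL hγ hγa'
  have Hρ := Hρ ν hν1 hν2
  obtain ⟨η, hη0, hηs, hηs2, hηt, Hη⟩ := H1b F γ hFL hγ hγb'
  have Hη := Hη ν hν1 hν2
  obtain ⟨η', hη'0, hη's, -, -, Hη'⟩ := H1c F γ hFL hγ hγc'
  have Hη' := Hη' ν hν1 hν2
  obtain ⟨η₂, hη₂0, hη₂s, -, -, Hη₂⟩ := H1d F γ hFL hγ hγf'
  have Hη₂ := Hη₂ ν hν1 hν2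
  obtain ⟨J, σ, hJlt, hJle, hJ, hσ0, hσ, -, Hs⟩ := H2 F γ hFL hγ hγd'
  have Hs := Hs ν hν1 hν2
  have hκ8 : 0 < κs / 8 := by positivity
  have hκlt : κs / 8 < κs / 4 := by linarith
  obtain ⟨Cs, w₀, δ, j₁, hCs, hw₀, hδ0, hδs, hDs, hD0, hj₀₁, Horg⟩ :=
    H3 F γ hγ hγe' b₀ P0 (κs / 8) j₀ prm η rA (fun i => CB * ((F.L : ℝ) ^ i / γ * θBal F.L γ b₀ P0 i ^ 2))
      hb₀ hp₀ hpW₀ hadm hκ8 hη0 hηs hηs2 hηt hrA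
  obtain ⟨jW, HWj⟩ := HW₂ P0 hpW₂ F γ (b₀ / 8) hγ hγ1 hb8
  -- constants: the volume factors and the seed budget constant (px5 ✓SeedBudget)
  have hL0 : (0 : ℝ) < F.L := by exact_mod_cast (zero_lt_one.trans F.hL.2)
  set V : ℕ → ℝ := fun i => ((F.L : ℝ) ^ i / γ) * (2 * (Fintype.card (Plaq (F.P i) 0) : ℝ) + (Fintype.card (PBond (F.P i) 0) : ℝ) ^ 2) with hVdef
  set W : ℕ → ℝ := fun i => (1 + 2 * ((F.L : ℝ) ^ i / γ) * (Fintype.card (Plaq (F.P i) 0) : ℝ)) * (Fintype.card (PBond (F.P i) 0) : ℝ) ^ 2 with hWdef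
  have hV0 : ∀ i, 0 ≤ V i := fun i => by positivity
  have hVW : ∀ i, V i ≤ 2 * W i := by
    intro i
    have hβ : 0 < (F.L : ℝ) ^ i / γ := by positivity
    have hP := one_le_card_plaq F i
    have hB := one_le_card_pbond_sq F i
    simp only [hVdef, hWdef]
    nlinarith [mul_pos hβ (lt_of_lt_of_le one_pos hP), mul_nonneg hβ.le (sub_nonneg.mpr hB),
      mul_nonneg (mul_nonneg hβ.le (sub_nonneg.mpr hP)) (sub_nonneg.mpr hB)]
  set Cpx : ℝ := 800 * Real.sqrt 32 * (Real.sqrt 800 * Real.sqrt (Real.sqrt 6)) / rA ^ 2 * (3 * (2 * (1 + 1 / (κs / 4 - κs / 8))) ^ 3) *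
    max (1 / b₀ ^ 2) (2 * CB) / 4 with hCpxdef
  have hCpx0 : 0 ≤ Cpx := by
    have : 0 < κs / 4 - κs / 8 := by linarith
    positivity
  -- positive seed sizes `σ' K = σ K + 1/(K+1)` (the seed triple wants `0 < ωT`)
  set σ' : ℕ → ℝ := fun K => σ K + 1 / ((K : ℝ) + 1) with hσ'def
  have hσ'pos : ∀ K, 0 < σ' K := fun K => by have := hσ0 K; simp only [hσ'def]; positivity
  have hσσ' : ∀ K, σ K ≤ σ' K := fun K => by simp only [hσ'def]; linarith [show (0:ℝ) < 1 / ((K:ℝ) + 1) by positivity]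
  have hσ'lim : Tendsto σ' atTop (𝓝 0) := by
    have h := hσ.add tendsto_one_div_add_atTop_nhds_zero_nat
    rw [add_zero] at h
    exact h
  have hs4lim : Tendsto (fun K => Real.sqrt (Real.sqrt (σ' K))) atTop (𝓝 0) := by
    have h1 : Tendsto (fun K => Real.sqrt (σ' K)) atTop (𝓝 0) := by
      have := (Real.continuous_sqrt.tendsto 0).comp hσ'lim
      rwa [Real.sqrt_zero] at this
    have := (Real.continuous_sqrt.tendsto 0).comp h1
    rwa [Real.sqrt_zero] at this
  -- the sequences that tend to zero in the height j
  have hDt0 : ∀ j, 0 ≤ ∑' k, δ (k + j) := fun j => tsum_nonneg fun k => hδ0 _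
  have hδle : ∀ j, δ j ≤ ∑' k, δ (k + j) := fun j => by
    have hs : Summable fun k => δ (k + j) := (summable_nat_add_iff j).mpr hδs
    have := hs.le_tsum 0 (fun k _ => hδ0 _)
    simpa using this
  have hδV_lim : Tendsto (fun j => δ j * V j) atTop (𝓝 0) := by
    have hg := hD0.const_mul 2
    rw [mul_zero] at hg
    refine squeeze_zero (fun j => mul_nonneg (hδ0 j) (hV0 j)) (fun j => ?_) hg
    calc δ j * V j ≤ (∑' k, δ (k + j)) * (2 * W j) := mul_le_mul (hδle j) (hVW j) (hV0 j) (hDt0 j)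
      _ = 2 * ((∑' k, δ (k + j)) * W j) := by ring
  have hη'_lim : Tendsto η' atTop (𝓝 0) := hη's.tendsto_atTop_zero
  have hη₂t_lim : Tendsto (fun j => ∑' k, η₂ (k + (j + 1))) atTop (𝓝 0) := (tendsto_sum_nat_add η₂).comp (tendsto_add_atTop_nat 1)
  -- the unit-scale expectations form a Cauchy sequence
  rw [Metric.cauchySeq_iff']
  intro t ht
  obtain ⟨δ₀, hδ₀, HTV⟩ := h4b (t / 8) (by positivity)
  -- choice of the height j
  have evj : ∀ᶠ j : ℕ in atTop, max (max j₀ j₁) jW ≤ j ∧ δ j * V j ≤ δ₀ / 2 ∧ η' j ≤ δ₀ / 2 ∧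
      ∑' k, η₂ (k + (j + 1)) ≤ 1 / 4 ∧ ∑' k, η₂ (k + (j + 1)) ≤ t / 16 := by
    have e1 : ∀ᶠ j : ℕ in atTop, δ j * V j ≤ δ₀ / 2 := hδV_lim.eventually (ge_mem_nhds (by positivity))
    have e4 : ∀ᶠ j : ℕ in atTop, η' j ≤ δ₀ / 2 := hη'_lim.eventually (ge_mem_nhds (by positivity))
    have e5 : ∀ᶠ j : ℕ in atTop, ∑' k, η₂ (k + (j + 1)) ≤ 1 / 4 := hη₂t_lim.eventually (ge_mem_nhds (by norm_num))
    have e6 : ∀ᶠ j : ℕ in atTop, ∑' k, η₂ (k + (j + 1)) ≤ t / 16 := hη₂t_lim.eventually (ge_mem_nhds (by positivity))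
    exact (eventually_ge_atTop _).and (e1.and (e4.and (e5.and e6)))
  obtain ⟨j, hjmax, hjδ, hjη, hjd4, hjdt⟩ := evj.exists
  have hj₀ : j₀ ≤ j := ((le_max_left _ _).trans (le_max_left _ _)).trans hjmax
  have hj₁ : j₁ ≤ j := ((le_max_right _ _).trans (le_max_left _ _)).trans hjmax
  have hjW : jW ≤ j := (le_max_right _ _).trans hjmax
  -- choice of the first cut-off K₀
  have evK : ∀ᶠ K : ℕ in atTop, j ≤ J K ∧ Cpx * Real.sqrt (Real.sqrt (σ' K)) ≤ w₀ ∧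
      Cs * (Cpx * Real.sqrt (Real.sqrt (σ' K))) * V j ≤ δ₀ / 2 := by
    have e1 : ∀ᶠ K : ℕ in atTop, Cpx * Real.sqrt (Real.sqrt (σ' K)) ≤ w₀ := by
      have h := hs4lim.const_mul Cpx
      rw [mul_zero] at h
      exact h.eventually (ge_mem_nhds hw₀)
    have e2 : ∀ᶠ K : ℕ in atTop, Cs * (Cpx * Real.sqrt (Real.sqrt (σ' K))) * V j ≤ δ₀ / 2 := by
      have h := ((hs4lim.const_mul Cpx).const_mul Cs).mul_const (V j)
      simp only [mul_zero, zero_mul] at h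
      exact h.eventually (ge_mem_nhds (by positivity))
    exact (hJ.eventually (eventually_ge_atTop j)).and (e1.and e2)
  obtain ⟨K₀, HK₀⟩ := eventually_atTop.mp (evK.and (eventually_ge_atTop 1))
  refine ⟨K₀, fun K' hK' => ?_⟩
  obtain ⟨⟨hjJ, hKw, hKτ⟩, hK₀1⟩ := HK₀ K₀ le_rfl
  have hTKlt : J K₀ < K₀ := hJlt K₀ hK₀1
  have hTK : J K₀ ≤ K₀ := hTKlt.le
  have hTK' : J K₀ ≤ K' := hTK.trans hK'
  have hjK : j ≤ K₀ := hjJ.trans hTK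
  have hjK' : j ≤ K' := hjK.trans hK'
  -- v17 (R-c + R-a): the SF-projected towers of the two runs below the seed height `J K₀` (constructed, not assumed)
  have hD : ∀ i, Measurable (descend F ℰp i : GaugeField (F.P (i + 1)) 0 (Matrix.specialUnitaryGroup (Fin 2) ℂ) → GaugeField (F.P i) 0 (Matrix.specialUnitaryGroup (Fin 2) ℂ)) :=
    fun i => measurable_descend F ℰp measurableE_ℰp i
  have hχm : ∀ i, Measurable ((fun i => fun U : GaugeField (F.P i) 0 (Matrix.specialUnitaryGroup (Fin 2) ℂ) => ENNReal.ofReal (sfCut (θBal F.L γ b₀ P0 i) U)) i) := fun i => ENNReal.measurable_ofReal.comp (measurable_sfCut _)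
  have hχ1 : ∀ i U, (fun i => fun U : GaugeField (F.P i) 0 (Matrix.specialUnitaryGroup (Fin 2) ℂ) => ENNReal.ofReal (sfCut (θBal F.L γ b₀ P0 i) U)) i U ≤ 1 := fun i U => ENNReal.ofReal_le_one.mpr (sfCut_le_one _ _)
  set μ₁ := SFTower.sfTowerG (fun i => descend F ℰp i) (fun i => fun U : GaugeField (F.P i) 0 (Matrix.specialUnitaryGroup (Fin 2) ℂ) => ENNReal.ofReal (sfCut (θBal F.L γ b₀ P0 i) U)) (ν K₀) (J K₀) with hμ₁def
  set μ₂ := SFTower.sfTowerG (fun i => descend F ℰp i) (fun i => fun U : GaugeField (F.P i) 0 (Matrix.specialUnitaryGroup (Fin 2) ℂ) => ENNReal.ofReal (sfCut (θBal F.L γ b₀ P0 i) U)) (ν K') (J K₀) with hμ₂def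
  have hanch₁ : ∀ i, J K₀ ≤ i → μ₁ i = ν K₀ i := fun i hi => SFTower.sfTowerG_of_le _ _ _ hi
  have hanch₂ : ∀ i, J K₀ ≤ i → μ₂ i = ν K' i := fun i hi => SFTower.sfTowerG_of_le _ _ _ hi
  have hcut₁ : ∀ i, i < J K₀ → μ₁ i = Measure.map (descend F ℰp i) ((μ₁ (i + 1)).withDensity ((fun i => fun U : GaugeField (F.P i) 0 (Matrix.specialUnitaryGroup (Fin 2) ℂ) => ENNReal.ofReal (sfCut (θBal F.L γ b₀ P0 i) U)) (i + 1))) :=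
    fun i hi => SFTower.sfTowerG_of_lt _ _ _ hi
  have hcut₂ : ∀ i, i < J K₀ → μ₂ i = Measure.map (descend F ℰp i) ((μ₂ (i + 1)).withDensity ((fun i => fun U : GaugeField (F.P i) 0 (Matrix.specialUnitaryGroup (Fin 2) ℂ) => ENNReal.ofReal (sfCut (θBal F.L γ b₀ P0 i) U)) (i + 1))) :=
    fun i hi => SFTower.sfTowerG_of_lt _ _ _ hi
  have hT₁ := SFTower.sfTower_le_and_deficit (fun i => descend F ℰp i) hD (fun i => fun U : GaugeField (F.P i) 0 (Matrix.specialUnitaryGroup (Fin 2) ℂ) => ENNReal.ofReal (sfCut (θBal F.L γ b₀ P0 i) U)) hχm hχ1 (ν K₀) μ₁ (J K₀)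
    (fun i hi => hν2 K₀ i (lt_of_lt_of_le hi hTK)) (hanch₁ _ le_rfl) hcut₁
  have hT₂ := SFTower.sfTower_le_and_deficit (fun i => descend F ℰp i) hD (fun i => fun U : GaugeField (F.P i) 0 (Matrix.specialUnitaryGroup (Fin 2) ℂ) => ENNReal.ofReal (sfCut (θBal F.L γ b₀ P0 i) U)) hχm hχ1 (ν K') μ₂ (J K₀)
    (fun i hi => hν2 K' i (lt_of_lt_of_le hi hTK')) (hanch₂ _ le_rfl) hcut₂
  have hle₁ : ∀ i, μ₁ i ≤ ν K₀ i := by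
    intro i
    by_cases hi : J K₀ ≤ i
    · rw [hanch₁ i hi]
    · exact (hT₁ (J K₀ - i) i (by omega)).1
  have hle₂ : ∀ i, μ₂ i ≤ ν K' i := by
    intro i
    by_cases hi : J K₀ ≤ i
    · rw [hanch₂ i hi]
    · exact (hT₂ (J K₀ - i) i (by omega)).1
  obtain ⟨ρ₁, hρ₁⟩ := Hρ K₀ (J K₀) hTK μ₁ hanch₁ hcut₁
  obtain ⟨ρ₂, hρ₂⟩ := Hρ K' (J K₀) hTK' μ₂ hanch₂ hcut₂
  -- the seed height, its threshold, its marginal unit and its (β)-profile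
  set T := J K₀ with hTdef
  have hθT : 0 < θBal F.L γ b₀ P0 T := T3MinimiserStabilityReduction.θBal_pos F.hL.2.le hγ hγ1 hb₀ _ _
  have hDT : 0 < (F.L : ℝ) ^ T / γ * θBal F.L γ b₀ P0 T ^ 2 := by positivity
  have hBρ : 0 < CB * ((F.L : ℝ) ^ T / γ * θBal F.L γ b₀ P0 T ^ 2) := mul_pos hCB hDT
  -- the seed: S2's square seed (weakened to `σ' K₀`) + (β)(β′) from S1aᴴ ⟹ the H-triple (px5 ✓p799301)
  obtain ⟨p1T, w1T, m1T, c1T, a1T⟩ := hρ₁ T hTK (hj₀.trans hjJ)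
  obtain ⟨p2T, w2T, m2T, c2T, a2T⟩ := hρ₂ T hTK' (hj₀.trans hjJ)
  have w1T' := w1T
  have w2T' := w2T
  rw [hanch₁ _ le_rfl] at w1T'
  rw [hanch₂ _ le_rfl] at w2T'
  have hsq := Hs K₀ K' hK' (ρ₁ T) (ρ₂ T) (fun U hU => ⟨p1T U hU, p2T U hU⟩) w1T' w2T' c1T c2T
  set wT : ℝ := 800 * Real.sqrt (32 * (CB * ((F.L : ℝ) ^ T / γ * θBal F.L γ b₀ P0 T ^ 2) + CB * ((F.L : ℝ) ^ T / γ * θBal F.L γ b₀ P0 T ^ 2))) *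
      Real.sqrt (800 * Real.sqrt (6 * (CB * ((F.L : ℝ) ^ T / γ * θBal F.L γ b₀ P0 T ^ 2) + CB * ((F.L : ℝ) ^ T / γ * θBal F.L γ b₀ P0 T ^ 2)))) / rA ^ 2 *
      Real.sqrt (Real.sqrt (σ' K₀)) * (3 * (2 * (1 + 1 / (κs / 4 - κs / 8))) ^ 3) / 4 with hwTdef
  have hwT0 : 0 ≤ wT := by
    have : 0 < κs / 4 - κs / 8 := by linarith
    positivity
  have hxT : wT / (((F.L : ℝ) ^ T / γ) * θBal F.L γ b₀ P0 T ^ 2) ≤ Cpx * Real.sqrt (Real.sqrt (σ' K₀)) := by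
    have hb := Summit.QuantumFields.YangMills.Theorems.OrganTangentSeedBudget.normalisedSeed_le_frame F (r := rA) (ω := σ' K₀)
      (S := 3 * (2 * (1 + 1 / (κs / 4 - κs / 8))) ^ 3) hγ hγ1 hb₀ hp₀.le hCB.le
      (by have : 0 < κs / 4 - κs / 8 := by linarith
          positivity) T
    have e1 : wT / (((F.L : ℝ) ^ T / γ) * θBal F.L γ b₀ P0 T ^ 2) =
        800 * Real.sqrt (32 * (CB * ((F.L : ℝ) ^ T / γ * θBal F.L γ b₀ P0 T ^ 2) + CB * ((F.L : ℝ) ^ T / γ * θBal F.L γ b₀ P0 T ^ 2))) *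
          Real.sqrt (800 * Real.sqrt (6 * (CB * ((F.L : ℝ) ^ T / γ * θBal F.L γ b₀ P0 T ^ 2) + CB * ((F.L : ℝ) ^ T / γ * θBal F.L γ b₀ P0 T ^ 2)))) / rA ^ 2 *
          Real.sqrt (Real.sqrt (σ' K₀)) * (3 * (2 * (1 + 1 / (κs / 4 - κs / 8))) ^ 3) /
          ((F.L : ℝ) ^ T / γ * θBal F.L γ b₀ P0 T ^ 2) / 4 := by
      simp only [hwTdef]; ring
    have e2 : Cpx * Real.sqrt (Real.sqrt (σ' K₀)) =
        800 * Real.sqrt 32 * (Real.sqrt 800 * Real.sqrt (Real.sqrt 6)) / rA ^ 2 * (3 * (2 * (1 + 1 / (κs / 4 - κs / 8))) ^ 3) *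
          max (1 / b₀ ^ 2) (2 * CB) * Real.sqrt (Real.sqrt (σ' K₀)) / 4 := by
      simp only [hCpxdef]; ring
    rw [e1, e2]
    exact div_le_div_of_nonneg_right hb (by norm_num)
  have hxw₀ : wT / (((F.L : ℝ) ^ T / γ) * θBal F.L γ b₀ P0 T ^ 2) ≤ w₀ := hxT.trans hKw
  have hseed : ∃ kT : PBond (F.P T) 0 → PBond (F.P T) 0 → ℝ, (∀ b b', 0 ≤ kT b b') ∧
      (∀ b, ∑ b', kT b b' * Real.exp (κs / 8 * (b.src.tdist b'.src : ℝ)) ≤ wT) ∧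
      HClauseSq (θBal F.L γ b₀ P0 T / 4) (rA / 2) kT (fun U => Real.log (ρ₁ T U) - Real.log (ρ₂ T U)) := by
    obtain ⟨kT, h0, hrow, hH⟩ :=
      Summit.QuantumFields.YangMills.Theorems.OrganTangentSeedHTriple.seedTriple_of_seed_of_analytic_three F T 0 hθT hrA hrA12 hBρ
        (hσ'pos K₀) hκlt (fun U => Real.log (ρ₁ T U)) (fun U => Real.log (ρ₂ T U))
        (fun b b' U V W Z hU hV hW hZ h1 h2 h3 h4 =>
          (hsq b b' U V W Z hU hV hW hZ h1 h2 h3 h4).trans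
            (mul_le_mul_of_nonneg_right (hσσ' K₀) (Real.exp_pos _).le))
        a1T a2T
    exact ⟨kT, h0, hrow, hH⟩
  -- the organ S3ᴴ on the run pair (K₀ ≤ K'), seed height T = J K₀, block top K₀, read at height j
  have hosc := Horg ν hν1 hν2 K₀ K' hK' T K₀ hTKlt le_rfl μ₁ μ₂ ρ₁ ρ₂
    (fun i hi _ => ⟨hanch₁ i hi, hanch₂ i hi⟩)
    (fun i hi => ⟨hcut₁ i hi, hcut₂ i hi⟩)
    (fun i hi hiK => by
      rw [hanch₁ i hi, hanch₂ i hi, hanch₁ (i + 1) (by omega), hanch₂ (i + 1) (by omega)]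
      exact ⟨hν2 K₀ i hiK, hν2 K' i (lt_of_lt_of_le hiK hK')⟩)
    (fun i _ => by
      haveI := hν3 K₀ i
      haveI := hν3 K' i
      exact ⟨isFiniteMeasure_of_le (ν K₀ i) (hle₁ i), isFiniteMeasure_of_le (ν K' i) (hle₂ i)⟩)
    (fun i hi hiT => by
      obtain ⟨p1, w1, m1, c1, a1⟩ := hρ₁ i hiT hi
      obtain ⟨p2, w2, m2, c2, a2⟩ := hρ₂ i (hiT.trans hK') hi
      exact ⟨fun U hU => ⟨p1 U hU, p2 U hU⟩, w1, w2, m1.imp fun _ h => ⟨K₀, hiT, h⟩, m2.imp fun _ h => ⟨K', hiT.trans hK', h⟩,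
        ((hle₁ i) _).trans (Hη K₀ i hiT), ((hle₂ i) _).trans (Hη K' i (hiT.trans hK')), ⟨c1, c2⟩, ⟨a1, a2⟩⟩)
    wT hwT0 hxw₀ hseed j hj₁ hjJ
  -- v17: masses and deficits of the SF-projected laws at the termination height j
  have hn : j + (J K₀ - j) = J K₀ := by omega
  have hηsj : Summable fun k => η₂ (k + (j + 1)) := (summable_nat_add_iff (j + 1)).mpr hη₂s
  have hsumη : ∀ (Kr : ℕ), J K₀ ≤ Kr → (∀ i, i ≤ Kr → ν Kr i {U | ¬ PlaqSmall (θBal F.L γ (b₀ / 2) P0 i) U} ≤ ENNReal.ofReal (η₂ i)) →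
      ∑ i ∈ Finset.range (J K₀ - j), ν Kr (j + 1 + i) {x | (fun i => fun U : GaugeField (F.P i) 0 (Matrix.specialUnitaryGroup (Fin 2) ℂ) => ENNReal.ofReal (sfCut (θBal F.L γ b₀ P0 i) U)) (j + 1 + i) x < 1} ≤ ENNReal.ofReal (∑' k, η₂ (k + (j + 1))) := by
    intro Kr hKr Hr
    calc ∑ i ∈ Finset.range (J K₀ - j), ν Kr (j + 1 + i) {x | (fun i => fun U : GaugeField (F.P i) 0 (Matrix.specialUnitaryGroup (Fin 2) ℂ) => ENNReal.ofReal (sfCut (θBal F.L γ b₀ P0 i) U)) (j + 1 + i) x < 1}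
        ≤ ∑ i ∈ Finset.range (J K₀ - j), ENNReal.ofReal (η₂ (j + 1 + i)) := Finset.sum_le_sum fun i hi => by
            rw [Finset.mem_range] at hi
            refine (measure_mono fun U hU => ?_).trans (Hr (j + 1 + i) (by omega))
            simp only [Set.mem_setOf_eq, ENNReal.ofReal_lt_one] at hU ⊢
            rw [θBal_half]
            exact not_plaqSmall_of_sfCut_lt_one (T3MinimiserStabilityReduction.θBal_pos F.hL.2.le hγ hγ1 hb₀ _ _) hU
      _ = ENNReal.ofReal (∑ i ∈ Finset.range (J K₀ - j), η₂ (j + 1 + i)) := (ENNReal.ofReal_sum_of_nonneg fun i _ => hη₂0 _).symm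
      _ ≤ ENNReal.ofReal (∑' k, η₂ (k + (j + 1))) := ENNReal.ofReal_le_ofReal (by
            calc ∑ i ∈ Finset.range (J K₀ - j), η₂ (j + 1 + i) = ∑ i ∈ Finset.range (J K₀ - j), η₂ (i + (j + 1)) :=
                  Finset.sum_congr rfl fun i _ => by rw [add_comm]
              _ ≤ ∑' k, η₂ (k + (j + 1)) := hηsj.sum_le_tsum _ fun i _ => hη₂0 _)
  have hdef₁ : ν K₀ j Set.univ ≤ μ₁ j Set.univ + ENNReal.ofReal (∑' k, η₂ (k + (j + 1))) :=
    (hT₁ (J K₀ - j) j hn).2.trans (add_le_add le_rfl (hsumη K₀ hTK fun i hi => Hη₂ K₀ i hi))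
  have hdef₂ : ν K' j Set.univ ≤ μ₂ j Set.univ + ENNReal.ofReal (∑' k, η₂ (k + (j + 1))) :=
    (hT₂ (J K₀ - j) j hn).2.trans (add_le_add le_rfl (hsumη K' hTK' fun i hi => Hη₂ K' i hi))
  have hd0 : 0 ≤ ∑' k, η₂ (k + (j + 1)) := tsum_nonneg fun k => hη₂0 _
  have hd1 : ∑' k, η₂ (k + (j + 1)) < 1 := by linarith only [hjd4]
  haveI hP₀ := hν3 K₀ j
  haveI hP₀' := hν3 K' j
  have hdhalf : ∑' k, η₂ (k + (j + 1)) ≤ 1 / 2 := by linarith only [hjd4]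
  obtain ⟨hm₁0, hm₁t, hm₁h⟩ := mass_facts (ν K₀ j) (μ₁ j) (hle₁ j) hd0 hdhalf hdef₁
  obtain ⟨hm₂0, hm₂t, hm₂h⟩ := mass_facts (ν K' j) (μ₂ j) (hle₂ j) hd0 hdhalf hdef₂
  haveI hP₁ : IsProbabilityMeasure ((μ₁ j Set.univ)⁻¹ • μ₁ j) := SFTower.isProbabilityMeasure_normalised _ hm₁0 hm₁t
  haveI hP₂ : IsProbabilityMeasure ((μ₂ j Set.univ)⁻¹ • μ₂ j) := SFTower.isProbabilityMeasure_normalised _ hm₂0 hm₂t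
  have hc₁ : 0 < (μ₁ j Set.univ).toReal⁻¹ := inv_pos.mpr (ENNReal.toReal_pos hm₁0 hm₁t)
  have hc₂ : 0 < (μ₂ j Set.univ).toReal⁻¹ := inv_pos.mpr (ENNReal.toReal_pos hm₂0 hm₂t)
  -- termination at height j: the sup-oscillation `τ` is within S4bᴴ's `δ₀`
  have hθj : 0 < θBal F.L γ b₀ P0 j := T3MinimiserStabilityReduction.θBal_pos F.hL.2.le hγ hγ1 hb₀ _ _
  have hθin : 0 < θBal F.L γ (Real.sqrt (b₀ / 8)) (P0 / 2) j := T3MinimiserStabilityReduction.θBal_pos F.hL.2.le hγ hγ1 hsb₀ _ _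
  have hθinle : θBal F.L γ (Real.sqrt (b₀ / 8)) (P0 / 2) j ≤ θBal F.L γ b₀ P0 j := by
    obtain ⟨-, -, h3, -⟩ := HWj j hjW
    rw [θBal_div8] at h3
    have hsq := sq_nonneg (Real.sqrt (θBal F.L γ b₀ P0 j / 8) / 16)
    linarith only [h3, hsq, hθj]
  have hτ0 : 0 ≤ (Cs * (wT / (((F.L : ℝ) ^ T / γ) * θBal F.L γ b₀ P0 T ^ 2)) + δ j) * V j :=
    mul_nonneg (add_nonneg (mul_nonneg hCs (div_nonneg hwT0 hDT.le)) (hδ0 j)) (hV0 j)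
  have hτD : (Cs * (wT / (((F.L : ℝ) ^ T / γ) * θBal F.L γ b₀ P0 T ^ 2)) + δ j) * V j ≤ δ₀ := by
    have h1 : Cs * (wT / (((F.L : ℝ) ^ T / γ) * θBal F.L γ b₀ P0 T ^ 2)) * V j ≤ δ₀ / 2 :=
      (mul_le_mul_of_nonneg_right (mul_le_mul_of_nonneg_left hxT hCs) (hV0 j)).trans hKτ
    have e : (Cs * (wT / (((F.L : ℝ) ^ T / γ) * θBal F.L γ b₀ P0 T ^ 2)) + δ j) * V j =
        Cs * (wT / (((F.L : ℝ) ^ T / γ) * θBal F.L γ b₀ P0 T ^ 2)) * V j + δ j * V j := by ring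
    rw [e]
    linarith only [h1, hjδ]
  obtain ⟨p1, w1, m1, c1, -⟩ := hρ₁ j hjK hj₀
  obtain ⟨p2, w2, m2, c2, -⟩ := hρ₂ j hjK' hj₀
  have h1win : PlaqSmall (θBal F.L γ b₀ P0 j) (1 : GaugeField (F.P j) 0 (Matrix.specialUnitaryGroup (Fin 2) ℂ)) :=
    Summit.QuantumFields.YangMills.Theorems.OrganTangentAnchorFreeOscillation.plaqSmall_one hθj
  have hTVn := HTV F j (θBal F.L γ (Real.sqrt (b₀ / 8)) (P0 / 2) j) (θBal F.L γ b₀ P0 j) _ (2 * η' j) hθin hθinle hτ0 hτD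
    (by linarith only [hη'0 j]) (by linarith only [hjη])
    ((μ₁ j Set.univ)⁻¹ • μ₁ j) ((μ₂ j Set.univ)⁻¹ • μ₂ j)
    (fun U => (μ₁ j Set.univ).toReal⁻¹ * ρ₁ j U) (fun U => (μ₂ j Set.univ).toReal⁻¹ * ρ₂ j U) hP₁ hP₂
    (fun U hU => ⟨mul_pos hc₁ (p1 U hU), mul_pos hc₂ (p2 U hU)⟩)
    (SFTower.normalised_withDensity _ _ _ w1 hm₁0 hm₁t) (SFTower.normalised_withDensity _ _ _ w2 hm₂0 hm₂t)
    (fun U hU => by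
      have hU' : PlaqSmall (θBal F.L γ b₀ P0 j) U := fun p => lt_of_lt_of_le (hU p) hθinle
      rw [SFTower.log_norm_diff hc₁ hc₂ (p1 U hU') (p2 U hU') (p1 1 h1win) (p2 1 h1win)]
      exact hosc U hU)
    (SFTower.normalised_tail _ _ (hle₁ j) _ (hη'0 j) (Hη' K₀ j hjK) hm₁h)
    (SFTower.normalised_tail _ _ (hle₂ j) _ (hη'0 j) (Hη' K' j hjK') hm₂h)
  have hTVj := SFTower.tv_transfer (ν K₀ j) (ν K' j) (μ₁ j) (μ₂ j) (hle₁ j) (hle₂ j) hd0 hd0 hd1 hd1 hdef₁ hdef₂ hTVn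
  -- the observable pulled up to height j (v10: any measurable `g`, `|g| ≤ 1`, on unit fields)
  have hAj : Measurable fun u : GaugeField (F.P j) 0 (Matrix.specialUnitaryGroup (Fin 2) ℂ) => g (Literature.MathematicalPhysics.QuantumFieldTheory.Balaban1983to89.T3LevelShift.unitShift F j (Averaging.iter (fun i => BlockAveraging.blockAvg (P := F.P j) (j := i) ℰp) j u)) :=
    hg.comp ((Literature.MathematicalPhysics.QuantumFieldTheory.Balaban1983to89.T3LevelShift.measurable_unitShift F j).comp
      (Literature.MathematicalPhysics.QuantumFieldTheory.Balaban1983to89.T4Continuum.measurable_iter _ (F.avgMeasurable_of_measurableE ℰp measurableE_ℰp j) j))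
  have hint := h4c F j (ν K₀ j) (ν K' j) (hν3 K₀ j) (hν3 K' j) (t / 8 + 2 * (∑' k, η₂ (k + (j + 1))) + 2 * (∑' k, η₂ (k + (j + 1)))) (by linarith only [ht, hd0]) hTVj
    (fun u => g (Literature.MathematicalPhysics.QuantumFieldTheory.Balaban1983to89.T3LevelShift.unitShift F j (Averaging.iter (fun i => BlockAveraging.blockAvg (P := F.P j) (j := i) ℰp) j u))) hAj (fun u => hgb _)
  beta_reduce at hint
  rw [integral_comp_unitA_nestedLaw F ν hν1 hν2 hg K₀ j hjK, integral_comp_unitA_nestedLaw F ν hν1 hν2 hg K' j hjK'] at hint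
  rw [Real.dist_eq, abs_sub_comm]
  linarith only [hint, hjdt, ht]

end Summit.QuantumFields.YangMills.Cruxes.FluctuationComparisonRegPrIntL.CompositionHScratch
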